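import Summits.HodgeConjecture.HodgeConjecture.Cruxes.H413.Lines.F0_T1InnerFormTraceIdentityAPI
import Literature.NumberTheory.Rogawski1990.AdelicStableOrbitalCentralH
import Literature.NumberTheory.Automorphic.OrbitalMeasureCentralMass
import Literature.NumberTheory.Rogawski1990.SingularClassOccursInAnisotropic
import Literature.NumberTheory.Rogawski1990.SingularStableClassTransfers
import Literature.NumberTheory.Rogawski1990.SingularObstruction
import Literature.NumberTheory.Automorphic.UnitaryGroupOrbitalSumSmul
import Literature.NumberTheory.Rogawski1990.AdelicInnerTransferStHalfSemisimple
import Literature.NumberTheory.Rogawski1990.StableClassOrbitalSumToAdelicSemisimple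
import Literature.NumberTheory.Rogawski1990.SingularObstructionClassWeight
import Literature.NumberTheory.Rogawski1990.AnisotropicUnitarySemisimple
import Literature.NumberTheory.Rogawski1990.StableClassTransferMap
import Literature.NumberTheory.Automorphic.GodementHeightFloor
import Literature.NumberTheory.Rogawski1990.LocalTransferAdmissibleFamilies
import Literature.NumberTheory.Rogawski1990.AdelicNormalisationSemisimple
import Literature.NumberTheory.Rogawski1990.AdelicKappaOrbitalSumSigned
import Literature.NumberTheory.Rogawski1990.AdelicInnerTransferWeighted
import Literature.NumberTheory.Rogawski1990.KottwitzSignEulerFactorisation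
import Literature.NumberTheory.Rogawski1990.OccurrenceOfArchMatch
import Literature.NumberTheory.Rogawski1990.KottwitzSignLocalTransport
import Literature.NumberTheory.Rogawski1990.KottwitzSignReadsObs
import Literature.NumberTheory.Rogawski1990.KottwitzSignLocalFlip
import Literature.NumberTheory.Rogawski1990.SingularObsHasseRealisation
import HarnessLib

/-!
# ENGINE T1 — `F0_T1InnerFormTraceIdentity` — (F-4) LAW T1b AT THE NON-REGULAR CLASSES (third workfile form, A-p16 (g21))

Imports the API workfile (which imports MAIN); holds ZERO `stub_`, ZERO `sorry`; nothing imports it.  Content = the (NR-M) closer (§§C0–M5) with every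
pin text consumed BY NAME from MAIN, and the API § `IsPinned.lawT1bNonreg` ⇒ `IsPinned.ellipticStabilisation`.
HONEST LABEL: HC_CM is proved only modulo the printed citations until rung 0 closes.
-/

/-!
# T1b-NONREG — THE MERGED API CLOSER `lawT1bNonreg_of_pins : … → 𝔨.LawT1bNonreg` (central ∨ singular), with `hD1`, `hst`, `(W, hW)` DISCHARGED BY NAME
# — EDITION v6.3 = v6.2 + O7 WORD #54 (1) ∕ F0P3a-p06 (g5) 13:13:04Z: the (b-s arch) pin `PinSingularArchInnerTransferSigned` takes the two `ArchSmooth` antecedents of ★ SETC's (ST-∞) clause (= MAIN ED 1.24b `PinSingularArchInnerTransfer` at the Kottwitz weights, δ); call site passes `hT.isArchTest hT′.isArchTest`.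
# — EDITION v6.2 = v6.1 with (d) DISCHARGED by ★ `kottwitzSignWeight_eq_of_singularObs_of_localFlip` (A-p18 (g20)) ∘ ★-pending local flips `KottwitzSignLocalFlip` (A-p17 (g16)): `lawT1bNonreg_of_kottwitz_pins` reads PINS ONLY. (v6.1: O7 OWNER WORDS #33 (3) PLAIN κ-conjunct, #39 (vii-c) `PinPsiConj` ⇒ (vii-e) a theorem, (d)-text `SignWeightReadsObs`) of v6 «W19 SIGNED CURRENCY over ABSTRACT Kottwitz-sign weight data» (RULING #116): the singular VALUE pins read SIGNED adelic sums; §M3 DISCHARGES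
# the signed st-half from ★-pending (SA-st-w) `AdelicInnerTransferWeighted` (A-p01 (g16)); §M4 `lawT1bNonreg_of_signed_pins` = pins + texts only;
# the signs enter as PARAMETERS `(E′ : ConjClasses (GpAdelic L H) → ℂ) (E : ConjClasses (GAdelic L) → ℂ)` — base-point-free class functions, to be
# instantiated by A-p18 (g20)'s ★-pending `kottwitzSignWeight L 3 H` ∕ `kottwitzSignWeight L 3 Φ₃` (`KottwitzSignCM`, WORD #24 (B)(C) tokens)
(Rogawski (1990), §14.5 pp. 238–239; Lemma 14.5.2 (a)(b)(c); Prop. 10.1.2 p. 146; §5.4 (5.4.1)–(5.4.3) pp. 72–73; §3.8 Prop. 3.8.1 p. 27) — HOME PASTE STOCK for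
the ED ≥ 1.24 API § (A-p16 (g21) over A-p16 (g20)'s two closers; F0P3a-plan (g5) RULING #113 (iv); O7 owner A-p01 (g15), SPEC-O7 v2.1∕v2.2, OWNER WORDS #14∕#17)

NOT a tree file.  Elaborates BY IMPORT against the tree MAIN `Cruxes/H413/Lines/F0_T1InnerFormTraceIdentity.lean` (ED 1.22; `ComparisonKit`'s fields are
edition-stable).  §C0–§C1 = A-p16 (g20)'s CENTRAL closer `T1bNonregCentral.paste.A-p16g20.lean` (sha16 bfeb30ad6bafbac3) VERBATIM; §S0–§S4 = A-p16 (g20)'s SINGULAR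
closer `T1bNonregSingular.skeleton.v2.A-p16g20.lean` (sha16 f82208605e01e15f) VERBATIM (pin texts pasted from SPEC-O7 v2.1∕v2.2, A-p01 (g15)); NEW here:

* §M1 **`lawT1b_singular_of_pins`** — §S4 `lawT1b_singular_of_pieces` with its three numerical inputs DISCHARGED BY NAME: `hD1` := ★ (D1-s) FILE 4 §3
  `adelicStableOrbitalIntegral_ofLocal_stableClassOf_eq_half_of_singularObs` (F0P3a-p02 (g5)), `hst` := ★ (SA-st)
  `adelicStableOrbitalSum_classesSelf_eq_adelicStableOrbitalIntegralG_of_mul_sub_eq_zero` (A-p01 (g15), p820520; `hmq := fun _ => rfl` at the kit's `mq`),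
  `(W, hW)` := ★ (i)-W-s `MatchingAdeleG₂.exists_singularClassWeight` (A-p16 (g21), p820646), `γH` := ★ T-s `exists_transfersTo_fst_eq_smul_one`; of the ★ heads'
  eight kit-side binder families FOUR are DERIVED here — admissibility of `mq v = (ψ_v)_* mG v` (THINNING A: ★ `IsAdmissibleOn.transport` + pin (x),
  `isAdmissibleOn_mq_of_isAdmissibleOn_mG`) and the three normalisations off the base point (THINNING B: ★ (NORM-s) `AdelicNormalisationSemisimple` §1∕§3,
  F0P3a-p08 (g6), p820860, from the pin `hpin : ∃ S₀, IsNormalisedOff 𝔨.mG (toAdelic γ₀) S₀` + pin (vi) level matching `hψK`); what is LEFT at `𝒪_st(γ₀)`: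
  `hadmG′` (ix-adm), `hadmAG′` (ix-admA), `hadmAG` (ix-admAq), `hpin` (ix-norm) — O7 OWNER WORD #20's four survivors —, a rational correspondent `γ` of `γ₀`
  in `U(Φ₃)` (★ `exists_corresponds_antidiagThree_all`), and the tensor witnesses of pins (ix′)∕(xi″) (`IsPinned.transfer_tensors` ∕ `.deltaTransfer_tensors`);
  the singular Hasse principle is ★ (h5) `MatchingAdeleG₂.singularObsHasse_of_charpoly_eq` (F0P5a-p03 (g5), `SingularObsHasseRealisation`), consumed BY NAME.
* §M2 **`lawT1bNonreg_of_pins : … → 𝔨.LawT1bNonreg`** — at a non-regular stable class `𝒪 = 𝒪_st(γ₀)` of the anisotropic `G′`, `γ₀` is semisimple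
  (★ `isSemisimpleElt_of_anisotropic`), so ★ `singular_semisimple_dichotomy`: CENTRAL `γ₀ = ζ•1` ⇒ §C1 `lawT1b_central_of_pins`; else `charpoly γ₀ = (X − a)²(X − b)`,
  `a ≠ b` of norm one ⇒ §M1, the four surviving per-`γ₀` binders being supplied by ∀-hypotheses guarded by `¬ IsRegularElt γ₀` (the (ix-adm)∕(ix-admA)∕
  (ix-admAq)∕(ix-norm) texts of O7 OWNER WORD #20 (3), which are UNGUARDED and hence imply these; every one is instantiated here exactly once, so renaming is free).
HONEST LABEL: nothing printed is consumed beyond the pins; HC_CM is proved only modulo the printed citations until rung 0 closes.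
-/

set_option autoImplicit false
set_option linter.dupNamespace false

noncomputable section

namespace Summit.HodgeConjecture.HodgeConjecture.Cruxes.H413.F0T1InnerFormTraceIdentity

open MeasureTheory Measure NumberField IsDedekindDomain Polynomial
open Literature.NumberTheory.Automorphic

namespace ComparisonKit

variable {L : Type} [Field L] [NumberField L] [IsCMField L] {H : Matrix (Fin 3) (Fin 3) L}
  {μ : Measure (UnitaryGroup.cmDatum L 3 H).automorphicQuotient} [(UnitaryGroup.cmDatum L 3 H).IsAutomorphicMeasure μ]
  (𝔨 : ComparisonKit L H μ)

/-! ## §C0 The pin texts (VERBATIM from SPEC-O7 v2.1, A-p01 (g15)) -/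

-- (`PinSJGCentral` is declared by the MAIN ∕ API workfile with this very text — consumed BY NAME.)

-- (`PinSJHCentralImage` is MAIN's ED 1.24a₀ pin of the same text — not re-declared here.)

-- (`PinMuAMassCentral` is declared by the MAIN ∕ API workfile with this very text — consumed BY NAME.)

-- (`PinCentralHVanish` is declared by the MAIN ∕ API workfile with this very text — consumed BY NAME.)

-- (`PinCentralValueTransfer` is declared by the MAIN ∕ API workfile with this very text — consumed BY NAME.)

-- (`LawT1bNonreg` is declared by the MAIN ∕ API workfile with this very text — consumed BY NAME.)

/-! ## §C1 The central branch -/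

/-- **A unitary scalar lies in the quasi-split group**: for `σ(ζ)ζ = 1` the scalar `ζ•1` is an element of `U(Φ₃)(L⁺)` (indeed of every `U(J)`).
[cite: Rogawski1990, §3.8 p. 27] -/
theorem exists_rational_splitForm_coe_eq_smul_one {ζ : L} (hζ : cmConjRingHom L ζ * ζ = 1) :
    ∃ γ : (UnitaryGroup.cmDatum L 3 (splitForm L 3)).Rational, ((γ.val : GL (Fin 3) L) : Matrix (Fin 3) (Fin 3) L) = ζ • (1 : Matrix (Fin 3) (Fin 3) L) := by
  have hζ0 : ζ ≠ 0 := fun h => by rw [h, mul_zero] at hζ; exact zero_ne_one hζ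
  have hunit : IsUnit (ζ • (1 : Matrix (Fin 3) (Fin 3) L)) := by
    rw [Matrix.isUnit_iff_isUnit_det, Matrix.det_smul, Matrix.det_one, mul_one]
    exact (IsUnit.mk0 ζ hζ0).pow _
  refine ⟨⟨hunit.unit, ?_⟩, hunit.unit_spec⟩
  rw [Literature.AlgebraicGeometry.ShimuraVarieties.mem_unitaryGroup_iff, hunit.unit_spec, Matrix.smul_one_eq_diagonal,
    Matrix.diagonal_map (map_zero _), Matrix.diagonal_transpose, ← Matrix.smul_one_eq_diagonal, ← Matrix.smul_one_eq_diagonal, Matrix.smul_mul,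
    Matrix.one_mul, Matrix.mul_smul, Matrix.mul_one, smul_smul]
  rw [mul_comm, hζ, one_smul]

/-- **(J at a central class)** `J(𝒪_st(ζ•1), f′) = α(𝒪) · f′(ζ•1 ⊗ 1)`: the stable class of a scalar is one conjugacy class, the adelic point is central,
the orbit space is a point of `μA`-mass `α(𝒪)` (pins (viii″), (viii⁵-c)). [cite: Rogawski1990, §14.5 p. 239; Prop. 10.1.2 (b)(2) p. 146] -/
theorem J_eq_of_coe_eq_smul_one
    (hJ : letI : ∀ g : GpAdelic L H, MeasurableSpace (GpAdelic L H ⧸ Subgroup.centralizer ({g} : Set (GpAdelic L H))) := fun _ => borel _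
      ∀ (c : 𝔨.StClass) (f' : TestGp L H),
        𝔨.J c f' = (𝔨.eSt c).orbitalSum (UnitaryGroup.adelicClassOrbitalIntegral L 3 H 𝔨.μA f'))
    (hα : ∀ c : 𝔨.StClass, 0 < 𝔨.α c) (hmass : 𝔨.PinMuAMassCentral)
    (c : 𝔨.StClass) (γ₀ : (UnitaryGroup.cmDatum L 3 H).Rational) (ζ : L)
    (hc : 𝔨.eSt c = Literature.NumberTheory.Rogawski1990.stableClassOf (cmConjRingHom L) H γ₀)
    (hζ : ((γ₀.val : GL (Fin 3) L) : Matrix (Fin 3) (Fin 3) L) = ζ • (1 : Matrix (Fin 3) (Fin 3) L)) (f' : TestGp L H) :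
    𝔨.J c f' = ((𝔨.α c : ℝ) : ℂ) * f' ((UnitaryGroup.cmDatum L 3 H).toAdelic γ₀) := by
  letI : ∀ g : GpAdelic L H, MeasurableSpace (GpAdelic L H ⧸ Subgroup.centralizer ({g} : Set (GpAdelic L H))) := fun _ => borel _
  -- the stable class of the scalar `γ₀` is the single conjugacy class `[γ₀]`
  have hsingle : ∀ δ, Literature.NumberTheory.Rogawski1990.IsStablyConj (cmConjRingHom L) H γ₀ δ → IsConj γ₀ δ := fun δ hst => by
    rw [Literature.NumberTheory.Rogawski1990.eq_of_isStablyConj_of_coe_eq_smul_one hζ hst]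
  rw [hJ, hc, Literature.NumberTheory.Rogawski1990.StableClass.orbitalSum_stableClassOf,
    Literature.NumberTheory.Rogawski1990.stableOrbitalSum_eq_of_forall_isConj _ hsingle]
  -- `γ₀` is central in `U(H)(L⁺)`, so `out [γ₀] = γ₀`, and `γ₀ ⊗ 1` is central in `U(H)(𝔸)`
  have hcomm : ∀ g : (UnitaryGroup.cmDatum L 3 H).Rational, g * γ₀ = γ₀ * g := fun g =>
    Subtype.ext (Literature.NumberTheory.Rogawski1990.commute_of_coe_eq_smul_one hζ g.val)
  have hout : (Quotient.out (ConjClasses.mk γ₀) : (UnitaryGroup.cmDatum L 3 H).Rational) = γ₀ :=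
    quotientOut_conjClassesMk_eq_of_forall_comm hcomm
  have hζ' : (((Quotient.out (ConjClasses.mk γ₀) : (UnitaryGroup.cmDatum L 3 H).Rational).val : GL (Fin 3) L) : Matrix (Fin 3) (Fin 3) L) =
      ζ • (1 : Matrix (Fin 3) (Fin 3) L) := by rw [hout, hζ]
  have hcen : ∀ g : (UnitaryGroup.cmDatum L 3 H).Adelic,
      g * (UnitaryGroup.cmDatum L 3 H).toAdelic (Quotient.out (ConjClasses.mk γ₀)) =
        (UnitaryGroup.cmDatum L 3 H).toAdelic (Quotient.out (ConjClasses.mk γ₀)) * g :=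
    Literature.NumberTheory.Rogawski1990.cmDatum_toAdelic_comm_of_smul_one hζ'
  change orbitalIntegral ((UnitaryGroup.cmDatum L 3 H).toAdelic (Quotient.out (ConjClasses.mk γ₀))) f' (𝔨.μA (ConjClasses.mk γ₀)) = _
  rw [orbitalIntegral_of_forall_comm hcen]
  -- the mass is `α(𝒪)` (pin (viii⁵-c) at `[γ₀]`, read at `out [γ₀] = γ₀`)
  have hm : 𝔨.μA (ConjClasses.mk γ₀) Set.univ = ENNReal.ofReal (𝔨.α c) :=
    (hmass (ConjClasses.mk γ₀) ζ hζ').trans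
      ((congrArg (fun δ : (UnitaryGroup.cmDatum L 3 H).Rational =>
          ENNReal.ofReal (𝔨.α (𝔨.eSt.symm (Literature.NumberTheory.Rogawski1990.stableClassOf (cmConjRingHom L) H δ)))) hout).trans
        (by simp only [← hc, Equiv.symm_apply_apply]))
  rw [hm, ENNReal.toReal_ofReal (hα c).le, hout, Complex.real_smul]

/-- **(SJ_G at a central class)** `SJ_G(𝒪_st(ζ•1), f) = α(𝒪) · f′(ζ•1 ⊗ 1)` for a transfer pair `f′ ↦ f` (pins (xii‴-C), (d-c); `ζ` is unitary by ★
`conj_mul_self_eq_one_of_smul_one_mem`, so `ζ•1 ∈ U(Φ₃)(L⁺)`). [cite: Rogawski1990, Prop. 10.1.2 (b)(2) p. 146; §14.5 p. 239] -/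
theorem SJG_eq_of_coe_eq_smul_one (hdet : H.det ≠ 0) (hC : 𝔨.PinSJGCentral) (hdc : 𝔨.PinCentralValueTransfer)
    {f' : TestGp L H} {f : TestG L} (hT : 𝔨.Transfer f' f)
    (c : 𝔨.StClass) (γ₀ : (UnitaryGroup.cmDatum L 3 H).Rational) (ζ : L)
    (hc : 𝔨.eSt c = Literature.NumberTheory.Rogawski1990.stableClassOf (cmConjRingHom L) H γ₀)
    (hζ : ((γ₀.val : GL (Fin 3) L) : Matrix (Fin 3) (Fin 3) L) = ζ • (1 : Matrix (Fin 3) (Fin 3) L)) :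
    𝔨.SJG c f = ((𝔨.α c : ℝ) : ℂ) * f' ((UnitaryGroup.cmDatum L 3 H).toAdelic γ₀) := by
  obtain ⟨γ, hγ⟩ := exists_rational_splitForm_coe_eq_smul_one (L := L)
    (Literature.NumberTheory.Rogawski1990.conj_mul_self_eq_one_of_smul_one_mem hdet γ₀.2 hζ)
  rw [hC c γ₀ γ ζ hc hζ hγ f, hdc f' f hT γ₀ γ ζ hζ hγ]

/-- **The `H`-classes transferring to a CENTRAL class are the central pairs `(ζ•1₂, ζ•1₁)`**: if `𝒪H ↦ 𝒪_st(ζ•1)` (pin (xiii-c): the image `ι(γH)`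
is `GL₃`-conjugate to the scalar `ζ•1`, hence equal to it), then every representative `γH` of `𝒪H` has `γH = (ζ•1₂, ζ•1₁)`.
[cite: Rogawski1990, §14.5 p. 239; §4.3 p. 42] -/
theorem coe_eq_smul_one_of_transfersTo_central (hTr : 𝔨.PinTransfersTo 𝔨.eStH) (c' : 𝔨.StClassH) (c : 𝔨.StClass)
    (γH : (UnitaryGroup.cmDatum L 2 (splitForm L 2)).Rational × (UnitaryGroup.cmDatum L 1 (splitForm L 1)).Rational)
    (γ₀ : (UnitaryGroup.cmDatum L 3 H).Rational) (ζ : L)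
    (hc' : 𝔨.eStH c' = Literature.NumberTheory.Rogawski1990.stableClassHOf (cmConjRingHom L) (splitForm L 2) (splitForm L 1) γH)
    (hc : 𝔨.eSt c = Literature.NumberTheory.Rogawski1990.stableClassOf (cmConjRingHom L) H γ₀)
    (hζ : ((γ₀.val : GL (Fin 3) L) : Matrix (Fin 3) (Fin 3) L) = ζ • (1 : Matrix (Fin 3) (Fin 3) L)) (ht : 𝔨.transfersTo c' c) :
    ((γH.1.val : GL (Fin 2) L) : Matrix (Fin 2) (Fin 2) L) = ζ • (1 : Matrix (Fin 2) (Fin 2) L) ∧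
      ((γH.2.val : GL (Fin 1) L) : Matrix (Fin 1) (Fin 1) L) = ζ • (1 : Matrix (Fin 1) (Fin 1) L) := by
  have h := (hTr c' c).mp ht
  rw [hc', hc, Literature.NumberTheory.Rogawski1990.StableClassH.transfersTo_mk_iff] at h
  -- `ι(γH) ∼ γ₀ = ζ•1` in `GL₃(L)` forces `ι(γH) = ζ•1`
  obtain ⟨x, hx⟩ := isConj_iff.mp h
  have hι : ((Literature.NumberTheory.Rogawski1990.endoEmb (cmConjRingHom L) (splitForm L 2) (splitForm L 1) (splitForm L 3)
      Literature.NumberTheory.Rogawski1990.endoForm_antidiagOne γH : GL (Fin 3) L) : Matrix (Fin 3) (Fin 3) L) = ζ • (1 : Matrix (Fin 3) (Fin 3) L) := by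
    have hcomm := Literature.NumberTheory.Rogawski1990.commute_of_coe_eq_smul_one hζ x
    set ι := (Literature.NumberTheory.Rogawski1990.endoEmb (cmConjRingHom L) (splitForm L 2) (splitForm L 1) (splitForm L 3)
        Literature.NumberTheory.Rogawski1990.endoForm_antidiagOne γH : GL (Fin 3) L) with hιdef
    have e : ι = (γ₀.val : GL (Fin 3) L) :=
      calc ι = x⁻¹ * (x * ι * x⁻¹) * x := by group
        _ = x⁻¹ * ((γ₀.val : GL (Fin 3) L) * x) := by rw [hx, mul_assoc]
        _ = x⁻¹ * (x * (γ₀.val : GL (Fin 3) L)) := by rw [hcomm]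
        _ = (γ₀.val : GL (Fin 3) L) := by rw [← mul_assoc, inv_mul_cancel, one_mul]
    rw [e, hζ]
  rw [Literature.NumberTheory.Rogawski1990.coe_endoEmb, Literature.NumberTheory.Rogawski1990.coe_endoGL_eq] at hι
  have e00 : ((γH.1.val : GL (Fin 2) L) : Matrix (Fin 2) (Fin 2) L) 0 0 = ζ := by simpa using congrFun (congrFun hι 0) 0
  have e01 : ((γH.1.val : GL (Fin 2) L) : Matrix (Fin 2) (Fin 2) L) 0 1 = 0 := by
    simpa [Matrix.one_apply_ne (by decide : (0 : Fin 3) ≠ 2)] using congrFun (congrFun hι 0) 2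
  have e10 : ((γH.1.val : GL (Fin 2) L) : Matrix (Fin 2) (Fin 2) L) 1 0 = 0 := by
    simpa [Matrix.one_apply_ne (by decide : (2 : Fin 3) ≠ 0)] using congrFun (congrFun hι 2) 0
  have e11 : ((γH.1.val : GL (Fin 2) L) : Matrix (Fin 2) (Fin 2) L) 1 1 = ζ := by simpa using congrFun (congrFun hι 2) 2
  have f00 : ((γH.2.val : GL (Fin 1) L) : Matrix (Fin 1) (Fin 1) L) 0 0 = ζ := by simpa using congrFun (congrFun hι 1) 1
  refine ⟨?_, ?_⟩
  · ext i j
    fin_cases i <;> fin_cases j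
    · simpa using e00
    · simpa using e01
    · simpa using e10
    · simpa using e11
  · ext i j
    fin_cases i; fin_cases j
    simpa using f00

/-- **(Σ SJ_H over a central class vanishes)**: on a transfer `f′ ↦ f^H`, every stable class `𝒪H ↦ 𝒪_st(ζ•1)` is a central pair (previous lemma), where
`SJ_H(𝒪H, f^H) = κ · f^H(γH ⊗ 1)` (pin (xiii‴-cc)) and `f^H(γH ⊗ 1) = 0` (clause (c-c), [Lemma 14.5.2 (c)]); so `SJHover(𝒪, f^H) = 0`.
[cite: Rogawski1990, Lemma 14.5.2 (c) p. 238; Prop. 10.1.2 (a) p. 146] -/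
theorem SJHover_eq_zero_of_coe_eq_smul_one (hTr : 𝔨.PinTransfersTo 𝔨.eStH) (hHi : 𝔨.PinSJHCentralImage) (hcc : 𝔨.PinCentralHVanish)
    {f' : TestGp L H} {fH : TestH L} (hTH : 𝔨.TransferH f' fH)
    (c : 𝔨.StClass) (γ₀ : (UnitaryGroup.cmDatum L 3 H).Rational) (ζ : L)
    (hc : 𝔨.eSt c = Literature.NumberTheory.Rogawski1990.stableClassOf (cmConjRingHom L) H γ₀)
    (hζ : ((γ₀.val : GL (Fin 3) L) : Matrix (Fin 3) (Fin 3) L) = ζ • (1 : Matrix (Fin 3) (Fin 3) L)) :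
    𝔨.SJHover c fH = 0 := by
  unfold SJHover
  refine (finsum_congr fun c' => ?_).trans finsum_zero
  obtain ⟨γH, hγH⟩ := Literature.NumberTheory.Rogawski1990.stableClassHOf_surjective (𝔨.eStH c'.1)
  obtain ⟨h1, h2⟩ := 𝔨.coe_eq_smul_one_of_transfersTo_central hTr c'.1 c γH γ₀ ζ hγH.symm hc hζ c'.2
  obtain ⟨κ, hκ⟩ := hHi c'.1 c γH ζ hγH.symm h1 c'.2 ⟨γ₀, hc, hζ⟩
  rw [hκ fH, hcc f' fH hTH γH ζ h1 h2, mul_zero]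

/-- **T1b AT THE CENTRAL CLASSES (the (C) branch of `LawT1bNonreg`)**: on a matching triple `(f′, f, f^H)`, at every stable class `𝒪 = 𝒪_st(ζ•1)` of
`U(H)(L⁺)`, `J(𝒪, f′) = SJ_G(𝒪, f) + ½ · SJHover(𝒪, f^H)` — both sides equal `α(𝒪) · f′(ζ•1 ⊗ 1)`, the `H`-term vanishing.  Inputs BY NAME: the MAIN
pins (viii″) `J = orbitalSum Φ_{μA}` + `0 < α` and (xiii-c) `PinTransfersTo`, and the SPEC-O7 pins (xii‴-C), (xiii‴-cc), (viii⁵-c), (c-c), (d-c).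
[cite: Rogawski1990, §14.5 p. 239; Prop. 10.1.2 p. 146; Lemma 14.5.2 (c) p. 238] -/
theorem lawT1b_central_of_pins (hdet : H.det ≠ 0)
    (hJ : letI : ∀ g : GpAdelic L H, MeasurableSpace (GpAdelic L H ⧸ Subgroup.centralizer ({g} : Set (GpAdelic L H))) := fun _ => borel _
      ∀ (c : 𝔨.StClass) (f' : TestGp L H),
        𝔨.J c f' = (𝔨.eSt c).orbitalSum (UnitaryGroup.adelicClassOrbitalIntegral L 3 H 𝔨.μA f'))
    (hα : ∀ c : 𝔨.StClass, 0 < 𝔨.α c) (hTr : 𝔨.PinTransfersTo 𝔨.eStH)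
    (hC : 𝔨.PinSJGCentral) (hHi : 𝔨.PinSJHCentralImage) (hmass : 𝔨.PinMuAMassCentral) (hcc : 𝔨.PinCentralHVanish)
    (hdc : 𝔨.PinCentralValueTransfer)
    {f' : TestGp L H} {f : TestG L} {fH : TestH L} (hm : 𝔨.Matches f' f fH)
    (c : 𝔨.StClass) (γ₀ : (UnitaryGroup.cmDatum L 3 H).Rational) (ζ : L)
    (hc : 𝔨.eSt c = Literature.NumberTheory.Rogawski1990.stableClassOf (cmConjRingHom L) H γ₀)
    (hζ : ((γ₀.val : GL (Fin 3) L) : Matrix (Fin 3) (Fin 3) L) = ζ • (1 : Matrix (Fin 3) (Fin 3) L)) :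
    𝔨.J c f' = 𝔨.SJG c f + (1 / 2 : ℂ) * 𝔨.SJHover c fH := by
  rw [𝔨.J_eq_of_coe_eq_smul_one hJ hα hmass c γ₀ ζ hc hζ f', 𝔨.SJG_eq_of_coe_eq_smul_one hdet hC hdc hm.1 c γ₀ ζ hc hζ,
    𝔨.SJHover_eq_zero_of_coe_eq_smul_one hTr hHi hcc hm.2 c γ₀ ζ hc hζ, mul_zero, add_zero]


/-! ## §S0 The singular pin texts in SIGNED currency (RULING #116, W19): abstract sign weights `E′` (inner form) ∕ `E` (split form) as parameters -/

/-- **(xii″-s, SIGNED) THE `SJ_G` SOCKET AT THE SINGULAR NON-CENTRAL CLASSES** (text over an abstract sign weight `E γ₀` on the `G(𝐀)`-classes of `𝒞_𝐀(γ₀)`;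
RULING #116: the stable orbital integral at a non-regular semisimple class is the SIGNED sum `Σ_δ e(δ) Φ(δ, f)` [§4.1 (4.1.2); §8.2 p. 117], here ★
`adelicKappaOrbitalIntegralG L H γ₀ E` — the unsigned ★ `adelicStableOrbitalIntegralG` of the v2.1 letter is print's `Φ^κ` at `U(2,1)(ℝ)`): at every stable class
`𝒪 = 𝒪_st(γ₀)` with `γ₀` split semisimple NON-central, `SJ_G(𝒪, f) = (α(𝒪)∕2) · Φ^{E,𝐀}_G(γ₀; ofLocalAdelic mq mqi; f)`.  `E := kottwitzSignWeight L 3 Φ₃` of ★-pending `KottwitzSignCM` (A-p18 (g20)); RHS spelled `adelicKappaOrbitalSum (MatchingAdeleG.classes L H γ₀) E …` = WORD #24 (C) token.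
[Rogawski1990, §14.5 p. 239; Prop. 10.1.2 (b)(1) p. 146; §4.1 (4.1.2) pp. 39–40; §8.2 p. 117] [Kottwitz1988, Thm. 1] -/
def PinSJGSingularSigned (E : ConjClasses (GAdelic L) → ℂ) : Prop :=
  letI : ∀ g : GAdelic L, MeasurableSpace (GAdelic L ⧸ Subgroup.centralizer ({g} : Set (GAdelic L))) := fun _ => borel _
  letI : ∀ γ : GInf L, MeasurableSpace (GInf L ⧸ Subgroup.centralizer ({γ} : Set (GInf L))) := fun _ => borel _
  letI : ∀ (v : HeightOneSpectrum (𝓞 ↥(maximalRealSubfield L))) (γ : (UnitaryGroup.cmDatum L 3 (splitForm L 3)).Local v),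
      MeasurableSpace ((UnitaryGroup.cmDatum L 3 (splitForm L 3)).Local v ⧸
        Subgroup.centralizer ({γ} : Set ((UnitaryGroup.cmDatum L 3 (splitForm L 3)).Local v))) := fun _ _ => borel _
  ∀ (𝒪 : 𝔨.StClass) (γ₀ : (UnitaryGroup.cmDatum L 3 H).Rational) (a b : L),
    𝔨.eSt 𝒪 = Literature.NumberTheory.Rogawski1990.stableClassOf (cmConjRingHom L) H γ₀ →
    a ≠ b →
    (((γ₀.val : GL (Fin 3) L) : Matrix (Fin 3) (Fin 3) L) - a • (1 : Matrix (Fin 3) (Fin 3) L)) *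
      (((γ₀.val : GL (Fin 3) L) : Matrix (Fin 3) (Fin 3) L) - b • (1 : Matrix (Fin 3) (Fin 3) L)) = 0 →
    (¬ ∃ ζ : L, ((γ₀.val : GL (Fin 3) L) : Matrix (Fin 3) (Fin 3) L) = ζ • (1 : Matrix (Fin 3) (Fin 3) L)) →
    ∀ f : TestG L, 𝔨.SJG 𝒪 f = ((𝔨.α 𝒪 / 2 : ℝ) : ℂ) *
      Literature.NumberTheory.Rogawski1990.adelicKappaOrbitalSum (Literature.NumberTheory.Rogawski1990.MatchingAdeleG.classes L H γ₀) E
        (UnitaryGroup.OrbitalMeasureFamily.ofLocalAdelic L 3 (splitForm L 3) 𝔨.mq 𝔨.mqi) ⇑f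

-- (`PinSingularEndoscopicMass` is declared by the MAIN ∕ API workfile with this very text — consumed BY NAME.)

/-- **(b-s, st-half, SIGNED) THE SINGULAR STABLE TRANSFER** (text; DISCHARGE PENDING (L3): the signed re-edition of ★ (SA-st) p820520 composed with the signed
(b-s arch) pin — until then this ∀-text is the closer's one non-value-pin hypothesis): on every transfer pair `f′ ↦ f` [(14.2.1)], at every split semisimple
NON-central `γ₀`, the SIGNED adelic stable orbital integrals agree: `Φ^{E′,𝐀}_{G′}(γ₀; ofLocalAdelic mG mGi; f′) = Φ^{E,𝐀}_G(γ₀; ofLocalAdelic mq mqi; f)`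
[Lemma 14.5.2 (b) st-half; Kottwitz1988 Prop. 2].  Finite places: `e_v = 1` and the Euler road of ★ ζ2∘ζ3; archimedean: the signed arch identity.
[Rogawski1990, §14.2 (14.2.1) p. 232; Lemma 14.5.2 (b) p. 238; §4.1 (4.1.2)] [Kottwitz1988, Prop. 2] -/
def SingularStableHalfSigned (E' : ConjClasses (GpAdelic L H) → ℂ)
    (E : ConjClasses (GAdelic L) → ℂ) : Prop :=
  letI : ∀ g : GpAdelic L H, MeasurableSpace (GpAdelic L H ⧸ Subgroup.centralizer ({g} : Set (GpAdelic L H))) := fun _ => borel _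
  letI : ∀ γ : GpInf L H, MeasurableSpace (GpInf L H ⧸ Subgroup.centralizer ({γ} : Set (GpInf L H))) := fun _ => borel _
  letI : ∀ (v : HeightOneSpectrum (𝓞 ↥(maximalRealSubfield L))) (γ : (UnitaryGroup.cmDatum L 3 H).Local v),
      MeasurableSpace ((UnitaryGroup.cmDatum L 3 H).Local v ⧸
        Subgroup.centralizer ({γ} : Set ((UnitaryGroup.cmDatum L 3 H).Local v))) := fun _ _ => borel _
  letI : ∀ g : GAdelic L, MeasurableSpace (GAdelic L ⧸ Subgroup.centralizer ({g} : Set (GAdelic L))) := fun _ => borel _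
  letI : ∀ γ : GInf L, MeasurableSpace (GInf L ⧸ Subgroup.centralizer ({γ} : Set (GInf L))) := fun _ => borel _
  letI : ∀ (v : HeightOneSpectrum (𝓞 ↥(maximalRealSubfield L))) (γ : (UnitaryGroup.cmDatum L 3 (splitForm L 3)).Local v),
      MeasurableSpace ((UnitaryGroup.cmDatum L 3 (splitForm L 3)).Local v ⧸
        Subgroup.centralizer ({γ} : Set ((UnitaryGroup.cmDatum L 3 (splitForm L 3)).Local v))) := fun _ _ => borel _
  ∀ (f' : TestGp L H) (f : TestG L), 𝔨.Transfer f' f →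
    ∀ (γ₀ : (UnitaryGroup.cmDatum L 3 H).Rational) (a b : L), a ≠ b → cmConjRingHom L a * a = 1 → cmConjRingHom L b * b = 1 →
    (((γ₀.val : GL (Fin 3) L) : Matrix (Fin 3) (Fin 3) L) - a • (1 : Matrix (Fin 3) (Fin 3) L)) *
      (((γ₀.val : GL (Fin 3) L) : Matrix (Fin 3) (Fin 3) L) - b • (1 : Matrix (Fin 3) (Fin 3) L)) = 0 →
    (¬ ∃ ζ : L, ((γ₀.val : GL (Fin 3) L) : Matrix (Fin 3) (Fin 3) L) = ζ • (1 : Matrix (Fin 3) (Fin 3) L)) →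
    ¬ Literature.NumberTheory.Rogawski1990.IsRegularElt (γ₀.val : GL (Fin 3) L) →
    Literature.NumberTheory.Rogawski1990.adelicKappaOrbitalSum (Literature.NumberTheory.Rogawski1990.MatchingAdeleG₂.classes L H H γ₀) E'
        (UnitaryGroup.OrbitalMeasureFamily.ofLocalAdelic L 3 H 𝔨.mG 𝔨.mGi) ⇑f' =
      Literature.NumberTheory.Rogawski1990.adelicKappaOrbitalSum (Literature.NumberTheory.Rogawski1990.MatchingAdeleG.classes L H γ₀) E
        (UnitaryGroup.OrbitalMeasureFamily.ofLocalAdelic L 3 (splitForm L 3) 𝔨.mq 𝔨.mqi) ⇑f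

/-- **(d) «KOTTWITZ'S SIGN IS THE ENDOSCOPIC CHARACTER ON THE SELF-CARRIER»** (text over an abstract adelic weight `E′`; DISCHARGE = A-p18 (g20)'s brick (d)
`kottwitzSignWeight ⟦q.adele⟧ = (−1)^{obs_s q}` on `𝒞′_𝐀(γ₀)` at a split-singular non-central `γ₀` — O7 OWNER WORDS #24 (A)(R-b), #33 (3)): read with `W := E′` it
is exactly the `hW` binder of ★ (D1-s) `hD1`, so the ★ sign-free count IS the signed split `Φ^{st}_{ofLocal} = ½(Φ^{1} + Φ^{e′})` the closer pairs with the
PLAIN κ-mass and the signed st-half. [Rogawski1990, §4.1 (4.1.2) pp. 39–40; §5.4 (5.4.2)–(5.4.3) pp. 72–73] [Kottwitz1986, §9] -/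
def SignWeightReadsObs (E' : ConjClasses (GpAdelic L H) → ℂ) : Prop :=
  ∀ (γ₀ : (UnitaryGroup.cmDatum L 3 H).Rational) (a b : L) (hab : a ≠ b), cmConjRingHom L a * a = 1 → cmConjRingHom L b * b = 1 →
    ∀ (hγ₀ : (((γ₀.val : GL (Fin 3) L) : Matrix (Fin 3) (Fin 3) L) - a • (1 : Matrix (Fin 3) (Fin 3) L)) *
      (((γ₀.val : GL (Fin 3) L) : Matrix (Fin 3) (Fin 3) L) - b • (1 : Matrix (Fin 3) (Fin 3) L)) = 0),
    (¬ ∃ ζ : L, ((γ₀.val : GL (Fin 3) L) : Matrix (Fin 3) (Fin 3) L) = ζ • (1 : Matrix (Fin 3) (Fin 3) L)) →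
    ∀ q : Literature.NumberTheory.Rogawski1990.MatchingAdeleG₂ L H H γ₀,
      E' (ConjClasses.mk q.adele) = if q.singularObs hab hγ₀ = 0 then 1 else -1

-- (`PinMuAShapeSingular` is declared by the MAIN ∕ API workfile with this very text — consumed BY NAME.)

-- (`PinSingularHRegularVanish` is MAIN's ED 1.24a₀ pin of the same text — not re-declared here.)

/-! ## §S1 The stable side at a singular non-central class (pins (xii″-s), (xiii″-s), (c-s), (xiii-c) + ★ T-s) -/

omit [NumberField L] [IsCMField L] in
/-- A matrix with characteristic polynomial `(X − a)²(X − b)`, `a ≠ b`, is NOT a scalar (a scalar `ζ•1₃` has `charpoly = (X − ζ)³`, whose only root is `ζ`).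
[cite: Rogawski1990, §3.8 Prop. 3.8.1 (a) p. 27] -/
theorem not_exists_coe_eq_smul_one_of_charpoly_eq {γ : Matrix (Fin 3) (Fin 3) L} {a b : L} (hab : a ≠ b)
    (hchar : γ.charpoly = (X - C a) ^ 2 * (X - C b)) : ¬ ∃ ζ : L, γ = ζ • (1 : Matrix (Fin 3) (Fin 3) L) := by
  rintro ⟨ζ, rfl⟩
  rw [Matrix.smul_one_eq_diagonal, Matrix.charpoly_diagonal, Finset.prod_const, Finset.card_univ, Fintype.card_fin] at hchar
  have hroot : ∀ x : L, ((X - C a) ^ 2 * (X - C b)).eval x = 0 → x = ζ := fun x hx => by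
    rw [← hchar, eval_pow, eval_sub, eval_X, eval_C] at hx
    exact sub_eq_zero.mp (pow_eq_zero_iff (by norm_num) |>.mp hx)
  have ha : a = ζ := hroot a (by simp)
  have hb : b = ζ := hroot b (by simp)
  exact hab (ha.trans hb.symm)

/-- **(SJ_G at a singular non-central class, SIGNED)** — pin (xii″-s, signed) read at `charpoly γ₀ = (X − a)²(X − b)`:
`SJ_G(𝒪, f) = (α(𝒪)∕2) · Φ^{E,𝐀}_G(γ₀; ofLocalAdelic mq mqi; f)`. [cite: Rogawski1990, §14.5 p. 239; Prop. 10.1.2 (b)(1) p. 146; §4.1 (4.1.2)] -/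
theorem SJG_eq_of_singular {E : ConjClasses (GAdelic L) → ℂ} (hS : 𝔨.PinSJGSingularSigned E)
    (c : 𝔨.StClass) (γ₀ : (UnitaryGroup.cmDatum L 3 H).Rational) (a b : L)
    (hc : 𝔨.eSt c = Literature.NumberTheory.Rogawski1990.stableClassOf (cmConjRingHom L) H γ₀) (hab : a ≠ b)
    (hγ : (((γ₀.val : GL (Fin 3) L) : Matrix (Fin 3) (Fin 3) L) - a • (1 : Matrix (Fin 3) (Fin 3) L)) *
      (((γ₀.val : GL (Fin 3) L) : Matrix (Fin 3) (Fin 3) L) - b • (1 : Matrix (Fin 3) (Fin 3) L)) = 0)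
    (hchar : ((γ₀.val : GL (Fin 3) L) : Matrix (Fin 3) (Fin 3) L).charpoly = (X - C a) ^ 2 * (X - C b)) (f : TestG L) :
    letI : ∀ g : GAdelic L, MeasurableSpace (GAdelic L ⧸ Subgroup.centralizer ({g} : Set (GAdelic L))) := fun _ => borel _
    letI : ∀ γ : GInf L, MeasurableSpace (GInf L ⧸ Subgroup.centralizer ({γ} : Set (GInf L))) := fun _ => borel _
    letI : ∀ (v : HeightOneSpectrum (𝓞 ↥(maximalRealSubfield L))) (γ : (UnitaryGroup.cmDatum L 3 (splitForm L 3)).Local v),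
        MeasurableSpace ((UnitaryGroup.cmDatum L 3 (splitForm L 3)).Local v ⧸
          Subgroup.centralizer ({γ} : Set ((UnitaryGroup.cmDatum L 3 (splitForm L 3)).Local v))) := fun _ _ => borel _
    𝔨.SJG c f = ((𝔨.α c / 2 : ℝ) : ℂ) *
      Literature.NumberTheory.Rogawski1990.adelicKappaOrbitalSum (Literature.NumberTheory.Rogawski1990.MatchingAdeleG.classes L H γ₀) E
        (UnitaryGroup.OrbitalMeasureFamily.ofLocalAdelic L 3 (splitForm L 3) 𝔨.mq 𝔨.mqi) ⇑f :=
  hS c γ₀ a b hc hab hγ (not_exists_coe_eq_smul_one_of_charpoly_eq hab hchar) f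

/-- **(Σ_{𝒪H ↦ 𝒪} SJ_H at a singular non-central class)**: the `H`-classes over `𝒪 = 𝒪_st(γ₀)` (`charpoly γ₀ = (X − a)²(X − b)`, `a ≠ b`) are `[(a•1₂, b)]`
and `[(h₂, a)]` (★ T-s `transfersTo_iff_exists_rep`); the H-side equality of the mass pin evaluates `SJ_H` at the first (`SJ_H = m_H · f^H(γH ⊗ 1)`), pin (c-s)
[Lemma 14.5.2 (a)] kills the second on transfers: `Σ_{𝒪H ↦ 𝒪} SJ_H(𝒪H, f^H) = m_H · f^H(γH ⊗ 1)` for any representative `γH = (a•1₂, b•1₁)`.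
[cite: Rogawski1990, §14.5 p. 239; Prop. 10.1.2 (a) p. 146; Lemma 14.5.2 (a) p. 238] -/
theorem SJHover_eq_of_singular (hTr : 𝔨.PinTransfersTo 𝔨.eStH) (hcs : 𝔨.PinSingularHRegularVanish)
    {f' : TestGp L H} {f : TestG L} {fH : TestH L} (hm : 𝔨.Matches f' f fH)
    (c : 𝔨.StClass) (γ₀ : (UnitaryGroup.cmDatum L 3 H).Rational) (a b : L)
    (hc : 𝔨.eSt c = Literature.NumberTheory.Rogawski1990.stableClassOf (cmConjRingHom L) H γ₀) (hab : a ≠ b)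
    (ha : cmConjRingHom L a * a = 1) (hb : cmConjRingHom L b * b = 1)
    (hγ : (((γ₀.val : GL (Fin 3) L) : Matrix (Fin 3) (Fin 3) L) - a • (1 : Matrix (Fin 3) (Fin 3) L)) *
      (((γ₀.val : GL (Fin 3) L) : Matrix (Fin 3) (Fin 3) L) - b • (1 : Matrix (Fin 3) (Fin 3) L)) = 0)
    (hchar : ((γ₀.val : GL (Fin 3) L) : Matrix (Fin 3) (Fin 3) L).charpoly = (X - C a) ^ 2 * (X - C b))
    (γH : (UnitaryGroup.cmDatum L 2 (splitForm L 2)).Rational × (UnitaryGroup.cmDatum L 1 (splitForm L 1)).Rational)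
    (h1 : ((γH.1.val : GL (Fin 2) L) : Matrix (Fin 2) (Fin 2) L) = a • (1 : Matrix (Fin 2) (Fin 2) L))
    (h2 : ((γH.2.val : GL (Fin 1) L) : Matrix (Fin 1) (Fin 1) L) = b • (1 : Matrix (Fin 1) (Fin 1) L))
    (mH : ℂ)
    (hSJH : ∀ fH : TestH L,
      𝔨.SJH (𝔨.eStH.symm (Literature.NumberTheory.Rogawski1990.stableClassHOf (cmConjRingHom L) (splitForm L 2) (splitForm L 1) γH)) fH =
        mH * fH (((UnitaryGroup.cmDatum L 2 (splitForm L 2)).toAdelic γH.1, (UnitaryGroup.cmDatum L 1 (splitForm L 1)).toAdelic γH.2))) :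
    𝔨.SJHover c fH =
      mH * fH (((UnitaryGroup.cmDatum L 2 (splitForm L 2)).toAdelic γH.1, (UnitaryGroup.cmDatum L 1 (splitForm L 1)).toAdelic γH.2)) := by
  -- the class of `γH` transfers to `𝒪`
  have hcH : 𝔨.eStH (𝔨.eStH.symm (Literature.NumberTheory.Rogawski1990.stableClassHOf (cmConjRingHom L) (splitForm L 2) (splitForm L 1) γH)) =
      Literature.NumberTheory.Rogawski1990.stableClassHOf (cmConjRingHom L) (splitForm L 2) (splitForm L 1) γH := Equiv.apply_symm_apply _ _
  have htH : 𝔨.transfersTo (𝔨.eStH.symm (Literature.NumberTheory.Rogawski1990.stableClassHOf (cmConjRingHom L) (splitForm L 2) (splitForm L 1) γH)) c := by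
    rw [hTr, hcH, hc]
    exact Literature.NumberTheory.Rogawski1990.transfersTo_mk_of_fst_eq_smul_one (cmConjRingHom L)
      Literature.NumberTheory.Rogawski1990.endoForm_antidiagOne hab hγ hchar γH h1 h2
  unfold SJHover
  rw [finsum_eq_single (fun c' : {c' : 𝔨.StClassH // 𝔨.transfersTo c' c} => 𝔨.SJH c'.1 fH) ⟨_, htH⟩]
  · exact hSJH fH
  · rintro ⟨c', hc'⟩ hne
    have ht' : (𝔨.eStH c').TransfersTo H Literature.NumberTheory.Rogawski1990.endoForm_antidiagOne
        (Literature.NumberTheory.Rogawski1990.stableClassOf (cmConjRingHom L) H γ₀) := by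
      rw [← hc]; exact (hTr c' c).mp hc'
    obtain ⟨γH', hγH', hcase⟩ := (Literature.NumberTheory.Rogawski1990.transfersTo_iff_exists_rep (cmConjRingHom L)
      Literature.NumberTheory.Rogawski1990.endoForm_antidiagOne two_ne_zero γ₀ hab ha hb hγ hchar _).mp ht'
    rcases hcase with ⟨h1', h2'⟩ | ⟨h1', h2'⟩
    · exfalso
      apply hne
      have heq : γH' = γH :=
        Prod.ext (Subtype.ext (Units.ext (h1'.trans h1.symm))) (Subtype.ext (Units.ext (h2'.trans h2.symm)))
      apply Subtype.ext
      show c' = _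
      apply 𝔨.eStH.injective
      rw [hcH, ← hγH', heq]
    · exact hcs f' f fH hm c' c γH' a b hγH'.symm hab h1' h2' hc'

/-- **THE STABLE SIDE at a singular non-central class (SIGNED)**: `SJ_G(𝒪, f) + ½ · Σ_{𝒪H ↦ 𝒪} SJ_H(𝒪H, f^H) = (α(𝒪)∕2) · Φ^{E,𝐀}_G(γ₀; f) + ½ · m_H · f^H(γH ⊗ 1)`.
[cite: Rogawski1990, §14.5 p. 239; Prop. 10.1.2 p. 146; Lemma 14.5.2 (a) p. 238] -/
theorem stableSide_eq_of_singular {E : ConjClasses (GAdelic L) → ℂ}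
    (hTr : 𝔨.PinTransfersTo 𝔨.eStH) (hS : 𝔨.PinSJGSingularSigned E) (hcs : 𝔨.PinSingularHRegularVanish)
    {f' : TestGp L H} {f : TestG L} {fH : TestH L} (hm : 𝔨.Matches f' f fH)
    (c : 𝔨.StClass) (γ₀ : (UnitaryGroup.cmDatum L 3 H).Rational) (a b : L)
    (hc : 𝔨.eSt c = Literature.NumberTheory.Rogawski1990.stableClassOf (cmConjRingHom L) H γ₀) (hab : a ≠ b)
    (ha : cmConjRingHom L a * a = 1) (hb : cmConjRingHom L b * b = 1)
    (hγ : (((γ₀.val : GL (Fin 3) L) : Matrix (Fin 3) (Fin 3) L) - a • (1 : Matrix (Fin 3) (Fin 3) L)) *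
      (((γ₀.val : GL (Fin 3) L) : Matrix (Fin 3) (Fin 3) L) - b • (1 : Matrix (Fin 3) (Fin 3) L)) = 0)
    (hchar : ((γ₀.val : GL (Fin 3) L) : Matrix (Fin 3) (Fin 3) L).charpoly = (X - C a) ^ 2 * (X - C b))
    (γH : (UnitaryGroup.cmDatum L 2 (splitForm L 2)).Rational × (UnitaryGroup.cmDatum L 1 (splitForm L 1)).Rational)
    (h1 : ((γH.1.val : GL (Fin 2) L) : Matrix (Fin 2) (Fin 2) L) = a • (1 : Matrix (Fin 2) (Fin 2) L))
    (h2 : ((γH.2.val : GL (Fin 1) L) : Matrix (Fin 1) (Fin 1) L) = b • (1 : Matrix (Fin 1) (Fin 1) L))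
    (mH : ℂ)
    (hSJH : ∀ fH : TestH L,
      𝔨.SJH (𝔨.eStH.symm (Literature.NumberTheory.Rogawski1990.stableClassHOf (cmConjRingHom L) (splitForm L 2) (splitForm L 1) γH)) fH =
        mH * fH (((UnitaryGroup.cmDatum L 2 (splitForm L 2)).toAdelic γH.1, (UnitaryGroup.cmDatum L 1 (splitForm L 1)).toAdelic γH.2))) :
    letI : ∀ g : GAdelic L, MeasurableSpace (GAdelic L ⧸ Subgroup.centralizer ({g} : Set (GAdelic L))) := fun _ => borel _
    letI : ∀ γ : GInf L, MeasurableSpace (GInf L ⧸ Subgroup.centralizer ({γ} : Set (GInf L))) := fun _ => borel _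
    letI : ∀ (v : HeightOneSpectrum (𝓞 ↥(maximalRealSubfield L))) (γ : (UnitaryGroup.cmDatum L 3 (splitForm L 3)).Local v),
        MeasurableSpace ((UnitaryGroup.cmDatum L 3 (splitForm L 3)).Local v ⧸
          Subgroup.centralizer ({γ} : Set ((UnitaryGroup.cmDatum L 3 (splitForm L 3)).Local v))) := fun _ _ => borel _
    𝔨.SJG c f + (1 / 2 : ℂ) * 𝔨.SJHover c fH = ((𝔨.α c / 2 : ℝ) : ℂ) *
      Literature.NumberTheory.Rogawski1990.adelicKappaOrbitalSum (Literature.NumberTheory.Rogawski1990.MatchingAdeleG.classes L H γ₀) E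
          (UnitaryGroup.OrbitalMeasureFamily.ofLocalAdelic L 3 (splitForm L 3) 𝔨.mq 𝔨.mqi) ⇑f +
      (1 / 2 : ℂ) * (mH * fH (((UnitaryGroup.cmDatum L 2 (splitForm L 2)).toAdelic γH.1, (UnitaryGroup.cmDatum L 1 (splitForm L 1)).toAdelic γH.2))) := by
  rw [𝔨.SJG_eq_of_singular hS c γ₀ a b hc hab hγ hchar f, 𝔨.SJHover_eq_of_singular hTr hcs hm c γ₀ a b hc hab ha hb hγ hchar γH h1 h2 mH hSJH]

/-! ## §S2 The J side at a singular non-central class (pins (viii″), (viii‴-s)) -/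

/-- **(J at a singular non-central class)** `J(𝒪, f′) = α(𝒪) · Φ^{st}_{ofLocal mG mGi}(𝒪, f′)`: on the rational classes `c ⊂ 𝒪 = 𝒪_st(γ₀)` the representative
`out c` is stably conjugate to `γ₀`, so it is killed by `(X − a)(X − b)` and is not a scalar (★ `mul_sub_smul_one_eq_zero_of_isConj`, `coe_eq_smul_one_of_isConj`),
pin (viii‴-s) reads `μA c = α(𝒪) • ofLocal mG mGi c`, and the weight factors out of the stable orbital sum (★ `adelicStableOrbitalIntegral_eq_mul_of_eq_ofReal_smul`).
[cite: Rogawski1990, §5.4 (5.4.1) p. 72; §14.5 pp. 237, 239] -/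
theorem J_eq_of_singular
    (hJ : letI : ∀ g : GpAdelic L H, MeasurableSpace (GpAdelic L H ⧸ Subgroup.centralizer ({g} : Set (GpAdelic L H))) := fun _ => borel _
      ∀ (c : 𝔨.StClass) (f' : TestGp L H),
        𝔨.J c f' = (𝔨.eSt c).orbitalSum (UnitaryGroup.adelicClassOrbitalIntegral L 3 H 𝔨.μA f'))
    (hα : ∀ c : 𝔨.StClass, 0 < 𝔨.α c) (hμ : 𝔨.PinMuAShapeSingular)
    (c : 𝔨.StClass) (γ₀ : (UnitaryGroup.cmDatum L 3 H).Rational) (a b : L)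
    (hc : 𝔨.eSt c = Literature.NumberTheory.Rogawski1990.stableClassOf (cmConjRingHom L) H γ₀) (hab : a ≠ b)
    (hγ : (((γ₀.val : GL (Fin 3) L) : Matrix (Fin 3) (Fin 3) L) - a • (1 : Matrix (Fin 3) (Fin 3) L)) *
      (((γ₀.val : GL (Fin 3) L) : Matrix (Fin 3) (Fin 3) L) - b • (1 : Matrix (Fin 3) (Fin 3) L)) = 0)
    (hchar : ((γ₀.val : GL (Fin 3) L) : Matrix (Fin 3) (Fin 3) L).charpoly = (X - C a) ^ 2 * (X - C b)) (f' : TestGp L H) :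
    letI : ∀ g : GpAdelic L H, MeasurableSpace (GpAdelic L H ⧸ Subgroup.centralizer ({g} : Set (GpAdelic L H))) := fun _ => borel _
    letI : ∀ γ : GpInf L H, MeasurableSpace (GpInf L H ⧸ Subgroup.centralizer ({γ} : Set (GpInf L H))) := fun _ => borel _
    letI : ∀ (v : HeightOneSpectrum (𝓞 ↥(maximalRealSubfield L))) (γ : (UnitaryGroup.cmDatum L 3 H).Local v),
        MeasurableSpace ((UnitaryGroup.cmDatum L 3 H).Local v ⧸
          Subgroup.centralizer ({γ} : Set ((UnitaryGroup.cmDatum L 3 H).Local v))) := fun _ _ => borel _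
    𝔨.J c f' = ((𝔨.α c : ℝ) : ℂ) *
      UnitaryGroup.adelicStableOrbitalIntegral L 3 H (UnitaryGroup.AdelicOrbitalMeasureFamily.ofLocal L 3 H 𝔨.mG 𝔨.mGi) ⇑f' (𝔨.eSt c) := by
  letI : ∀ g : GpAdelic L H, MeasurableSpace (GpAdelic L H ⧸ Subgroup.centralizer ({g} : Set (GpAdelic L H))) := fun _ => borel _
  letI : ∀ γ : GpInf L H, MeasurableSpace (GpInf L H ⧸ Subgroup.centralizer ({γ} : Set (GpInf L H))) := fun _ => borel _
  letI : ∀ (v : HeightOneSpectrum (𝓞 ↥(maximalRealSubfield L))) (γ : (UnitaryGroup.cmDatum L 3 H).Local v),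
      MeasurableSpace ((UnitaryGroup.cmDatum L 3 H).Local v ⧸
        Subgroup.centralizer ({γ} : Set ((UnitaryGroup.cmDatum L 3 H).Local v))) := fun _ _ => borel _
  rw [hJ]
  change UnitaryGroup.adelicStableOrbitalIntegral L 3 H 𝔨.μA ⇑f' (𝔨.eSt c) = _
  refine UnitaryGroup.adelicStableOrbitalIntegral_eq_mul_of_eq_ofReal_smul L 3 H (hα c).le (fun c' hc' => ?_) ⇑f'
  -- `out c'` is stably conjugate to `γ₀`
  have hmk : ConjClasses.mk (Quotient.out c') = c' := Quotient.out_eq c'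
  have hst : Literature.NumberTheory.Rogawski1990.IsStablyConj (cmConjRingHom L) H γ₀ (Quotient.out c') := by
    rw [← Literature.NumberTheory.Rogawski1990.mk_mem_conjClassesIn_iff]
    show ConjClasses.mk (Quotient.out c') ∈ {c | Literature.NumberTheory.Rogawski1990.StableClass.ofConjClass c =
      Literature.NumberTheory.Rogawski1990.stableClassOf (cmConjRingHom L) H γ₀}
    rw [hmk, Set.mem_setOf_eq, hc', hc]
  have hγ' := Literature.NumberTheory.Rogawski1990.mul_sub_smul_one_eq_zero_of_isConj hst hγ
  have hnc' : ¬ ∃ ζ : L, (((Quotient.out c').val : GL (Fin 3) L) : Matrix (Fin 3) (Fin 3) L) = ζ • (1 : Matrix (Fin 3) (Fin 3) L) := by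
    rintro ⟨ζ, hζ⟩
    exact not_exists_coe_eq_smul_one_of_charpoly_eq hab hchar ⟨ζ, Literature.NumberTheory.Rogawski1990.coe_eq_smul_one_of_isConj hst.symm hζ⟩
  have hw : 𝔨.eSt.symm (Literature.NumberTheory.Rogawski1990.stableClassOf (cmConjRingHom L) H (Quotient.out c')) = c := by
    rw [Equiv.symm_apply_eq, hc, Literature.NumberTheory.Rogawski1990.stableClassOf_eq_iff]
    exact hst.symm
  have key := hμ c' a b hab hγ' hnc'
  exact hw ▸ key
/-! ## §S3 Assembly (SIGNED): T1b at a singular non-central class from ★ `hD1` (sign-free count), ★ W19-glue, the signed st-half and the mass equalities -/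

/-- **T1b AT A SINGULAR NON-CENTRAL CLASS from its pieces, SIGNED currency**: `J(𝒪, f′) = α(𝒪)·Φ^{st}_{ofLocal}(𝒪, f′)` (§S2) `= α·½(Φ^{1,𝐀} + Φ^{κ,𝐀})` (★ sign-free
count `hD1`) `= α·½(Φ^{E′,𝐀} + Φ^{W′,𝐀})` (`hbridge`, ★ W19-glue p821926: `e·(1+κ) = 1+κ` class by class) `= (α∕2)·Φ^{E,𝐀}_G(f) + ½·α·Φ^{W′,𝐀}(f′)` (signed st-half
`hstE`) `= SJ_G + ½·m_H·f^H(γH) = SJ_G + ½ Σ_{𝒪H ↦ 𝒪} SJ_H` (κ-mass `hκm`, §S1). [cite: Rogawski1990, §14.5 p. 239; Lemma 14.5.2 (b) p. 238; Prop. 10.1.2 p. 146;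
§5.4 (5.4.1)–(5.4.3) pp. 72–73; §4.1 (4.1.2)] [cite: Kottwitz1988, Thm. 1] -/
theorem lawT1b_singular_of_pieces {E' : ConjClasses (GpAdelic L H) → ℂ}
    {E : ConjClasses (GAdelic L) → ℂ}
    (hJ : letI : ∀ g : GpAdelic L H, MeasurableSpace (GpAdelic L H ⧸ Subgroup.centralizer ({g} : Set (GpAdelic L H))) := fun _ => borel _
      ∀ (c : 𝔨.StClass) (f' : TestGp L H),
        𝔨.J c f' = (𝔨.eSt c).orbitalSum (UnitaryGroup.adelicClassOrbitalIntegral L 3 H 𝔨.μA f'))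
    (hα : ∀ c : 𝔨.StClass, 0 < 𝔨.α c) (hTr : 𝔨.PinTransfersTo 𝔨.eStH)
    (hS : 𝔨.PinSJGSingularSigned E) (hμ : 𝔨.PinMuAShapeSingular) (hcs : 𝔨.PinSingularHRegularVanish)
    {f' : TestGp L H} {f : TestG L} {fH : TestH L} (hm : 𝔨.Matches f' f fH)
    (c : 𝔨.StClass) (γ₀ : (UnitaryGroup.cmDatum L 3 H).Rational) (a b : L)
    (hc : 𝔨.eSt c = Literature.NumberTheory.Rogawski1990.stableClassOf (cmConjRingHom L) H γ₀) (hab : a ≠ b)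
    (ha : cmConjRingHom L a * a = 1) (hb : cmConjRingHom L b * b = 1)
    (hγ : (((γ₀.val : GL (Fin 3) L) : Matrix (Fin 3) (Fin 3) L) - a • (1 : Matrix (Fin 3) (Fin 3) L)) *
      (((γ₀.val : GL (Fin 3) L) : Matrix (Fin 3) (Fin 3) L) - b • (1 : Matrix (Fin 3) (Fin 3) L)) = 0)
    (hchar : ((γ₀.val : GL (Fin 3) L) : Matrix (Fin 3) (Fin 3) L).charpoly = (X - C a) ^ 2 * (X - C b))
    (γH : (UnitaryGroup.cmDatum L 2 (splitForm L 2)).Rational × (UnitaryGroup.cmDatum L 1 (splitForm L 1)).Rational)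
    (h1 : ((γH.1.val : GL (Fin 2) L) : Matrix (Fin 2) (Fin 2) L) = a • (1 : Matrix (Fin 2) (Fin 2) L))
    (h2 : ((γH.2.val : GL (Fin 1) L) : Matrix (Fin 1) (Fin 1) L) = b • (1 : Matrix (Fin 1) (Fin 1) L))
    (W W' : ConjClasses (GpAdelic L H) → ℂ) (mH : ℂ)
    (hSJH : ∀ fH : TestH L,
      𝔨.SJH (𝔨.eStH.symm (Literature.NumberTheory.Rogawski1990.stableClassHOf (cmConjRingHom L) (splitForm L 2) (splitForm L 1) γH)) fH =
        mH * fH (((UnitaryGroup.cmDatum L 2 (splitForm L 2)).toAdelic γH.1, (UnitaryGroup.cmDatum L 1 (splitForm L 1)).toAdelic γH.2)))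
    (hκm : letI : ∀ g : GpAdelic L H, MeasurableSpace (GpAdelic L H ⧸ Subgroup.centralizer ({g} : Set (GpAdelic L H))) := fun _ => borel _
      letI : ∀ γ : GpInf L H, MeasurableSpace (GpInf L H ⧸ Subgroup.centralizer ({γ} : Set (GpInf L H))) := fun _ => borel _
      letI : ∀ (v : HeightOneSpectrum (𝓞 ↥(maximalRealSubfield L))) (γ : (UnitaryGroup.cmDatum L 3 H).Local v),
          MeasurableSpace ((UnitaryGroup.cmDatum L 3 H).Local v ⧸
            Subgroup.centralizer ({γ} : Set ((UnitaryGroup.cmDatum L 3 H).Local v))) := fun _ _ => borel _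
      letI : ∀ g : GAdelic L, MeasurableSpace (GAdelic L ⧸ Subgroup.centralizer ({g} : Set (GAdelic L))) := fun _ => borel _
      letI : ∀ γ : GInf L, MeasurableSpace (GInf L ⧸ Subgroup.centralizer ({γ} : Set (GInf L))) := fun _ => borel _
      letI : ∀ (v : HeightOneSpectrum (𝓞 ↥(maximalRealSubfield L))) (γ : (UnitaryGroup.cmDatum L 3 (splitForm L 3)).Local v),
          MeasurableSpace ((UnitaryGroup.cmDatum L 3 (splitForm L 3)).Local v ⧸
            Subgroup.centralizer ({γ} : Set ((UnitaryGroup.cmDatum L 3 (splitForm L 3)).Local v))) := fun _ _ => borel _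
      ((𝔨.α c : ℝ) : ℂ) *
          Literature.NumberTheory.Rogawski1990.adelicKappaOrbitalSum (Literature.NumberTheory.Rogawski1990.MatchingAdeleG₂.classes L H H γ₀) W'
            (UnitaryGroup.OrbitalMeasureFamily.ofLocalAdelic L 3 H 𝔨.mG 𝔨.mGi) ⇑f' =
        mH * fH (((UnitaryGroup.cmDatum L 2 (splitForm L 2)).toAdelic γH.1, (UnitaryGroup.cmDatum L 1 (splitForm L 1)).toAdelic γH.2)))
    (hD1 : letI : ∀ g : GpAdelic L H, MeasurableSpace (GpAdelic L H ⧸ Subgroup.centralizer ({g} : Set (GpAdelic L H))) := fun _ => borel _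
      letI : ∀ γ : GpInf L H, MeasurableSpace (GpInf L H ⧸ Subgroup.centralizer ({γ} : Set (GpInf L H))) := fun _ => borel _
      letI : ∀ (v : HeightOneSpectrum (𝓞 ↥(maximalRealSubfield L))) (γ : (UnitaryGroup.cmDatum L 3 H).Local v),
          MeasurableSpace ((UnitaryGroup.cmDatum L 3 H).Local v ⧸
            Subgroup.centralizer ({γ} : Set ((UnitaryGroup.cmDatum L 3 H).Local v))) := fun _ _ => borel _
      letI : ∀ g : GAdelic L, MeasurableSpace (GAdelic L ⧸ Subgroup.centralizer ({g} : Set (GAdelic L))) := fun _ => borel _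
      letI : ∀ γ : GInf L, MeasurableSpace (GInf L ⧸ Subgroup.centralizer ({γ} : Set (GInf L))) := fun _ => borel _
      letI : ∀ (v : HeightOneSpectrum (𝓞 ↥(maximalRealSubfield L))) (γ : (UnitaryGroup.cmDatum L 3 (splitForm L 3)).Local v),
          MeasurableSpace ((UnitaryGroup.cmDatum L 3 (splitForm L 3)).Local v ⧸
            Subgroup.centralizer ({γ} : Set ((UnitaryGroup.cmDatum L 3 (splitForm L 3)).Local v))) := fun _ _ => borel _
      UnitaryGroup.adelicStableOrbitalIntegral L 3 H (UnitaryGroup.AdelicOrbitalMeasureFamily.ofLocal L 3 H 𝔨.mG 𝔨.mGi) ⇑f'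
          (Literature.NumberTheory.Rogawski1990.stableClassOf (cmConjRingHom L) H γ₀) =
        (1 / 2 : ℂ) * (Literature.NumberTheory.Rogawski1990.adelicStableOrbitalSum (Literature.NumberTheory.Rogawski1990.MatchingAdeleG₂.classes L H H γ₀)
            (UnitaryGroup.OrbitalMeasureFamily.ofLocalAdelic L 3 H 𝔨.mG 𝔨.mGi) ⇑f' +
          Literature.NumberTheory.Rogawski1990.adelicKappaOrbitalSum (Literature.NumberTheory.Rogawski1990.MatchingAdeleG₂.classes L H H γ₀) W
            (UnitaryGroup.OrbitalMeasureFamily.ofLocalAdelic L 3 H 𝔨.mG 𝔨.mGi) ⇑f'))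
    (hbridge : letI : ∀ g : GpAdelic L H, MeasurableSpace (GpAdelic L H ⧸ Subgroup.centralizer ({g} : Set (GpAdelic L H))) := fun _ => borel _
      letI : ∀ γ : GpInf L H, MeasurableSpace (GpInf L H ⧸ Subgroup.centralizer ({γ} : Set (GpInf L H))) := fun _ => borel _
      letI : ∀ (v : HeightOneSpectrum (𝓞 ↥(maximalRealSubfield L))) (γ : (UnitaryGroup.cmDatum L 3 H).Local v),
          MeasurableSpace ((UnitaryGroup.cmDatum L 3 H).Local v ⧸
            Subgroup.centralizer ({γ} : Set ((UnitaryGroup.cmDatum L 3 H).Local v))) := fun _ _ => borel _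
      letI : ∀ g : GAdelic L, MeasurableSpace (GAdelic L ⧸ Subgroup.centralizer ({g} : Set (GAdelic L))) := fun _ => borel _
      letI : ∀ γ : GInf L, MeasurableSpace (GInf L ⧸ Subgroup.centralizer ({γ} : Set (GInf L))) := fun _ => borel _
      letI : ∀ (v : HeightOneSpectrum (𝓞 ↥(maximalRealSubfield L))) (γ : (UnitaryGroup.cmDatum L 3 (splitForm L 3)).Local v),
          MeasurableSpace ((UnitaryGroup.cmDatum L 3 (splitForm L 3)).Local v ⧸
            Subgroup.centralizer ({γ} : Set ((UnitaryGroup.cmDatum L 3 (splitForm L 3)).Local v))) := fun _ _ => borel _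
      (1 / 2 : ℂ) * (Literature.NumberTheory.Rogawski1990.adelicKappaOrbitalSum (Literature.NumberTheory.Rogawski1990.MatchingAdeleG₂.classes L H H γ₀) E'
            (UnitaryGroup.OrbitalMeasureFamily.ofLocalAdelic L 3 H 𝔨.mG 𝔨.mGi) ⇑f' +
          Literature.NumberTheory.Rogawski1990.adelicKappaOrbitalSum (Literature.NumberTheory.Rogawski1990.MatchingAdeleG₂.classes L H H γ₀) W'
            (UnitaryGroup.OrbitalMeasureFamily.ofLocalAdelic L 3 H 𝔨.mG 𝔨.mGi) ⇑f') =
        (1 / 2 : ℂ) * (Literature.NumberTheory.Rogawski1990.adelicStableOrbitalSum (Literature.NumberTheory.Rogawski1990.MatchingAdeleG₂.classes L H H γ₀)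
            (UnitaryGroup.OrbitalMeasureFamily.ofLocalAdelic L 3 H 𝔨.mG 𝔨.mGi) ⇑f' +
          Literature.NumberTheory.Rogawski1990.adelicKappaOrbitalSum (Literature.NumberTheory.Rogawski1990.MatchingAdeleG₂.classes L H H γ₀) W
            (UnitaryGroup.OrbitalMeasureFamily.ofLocalAdelic L 3 H 𝔨.mG 𝔨.mGi) ⇑f'))
    (hstE : letI : ∀ g : GpAdelic L H, MeasurableSpace (GpAdelic L H ⧸ Subgroup.centralizer ({g} : Set (GpAdelic L H))) := fun _ => borel _
      letI : ∀ γ : GpInf L H, MeasurableSpace (GpInf L H ⧸ Subgroup.centralizer ({γ} : Set (GpInf L H))) := fun _ => borel _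
      letI : ∀ (v : HeightOneSpectrum (𝓞 ↥(maximalRealSubfield L))) (γ : (UnitaryGroup.cmDatum L 3 H).Local v),
          MeasurableSpace ((UnitaryGroup.cmDatum L 3 H).Local v ⧸
            Subgroup.centralizer ({γ} : Set ((UnitaryGroup.cmDatum L 3 H).Local v))) := fun _ _ => borel _
      letI : ∀ g : GAdelic L, MeasurableSpace (GAdelic L ⧸ Subgroup.centralizer ({g} : Set (GAdelic L))) := fun _ => borel _
      letI : ∀ γ : GInf L, MeasurableSpace (GInf L ⧸ Subgroup.centralizer ({γ} : Set (GInf L))) := fun _ => borel _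
      letI : ∀ (v : HeightOneSpectrum (𝓞 ↥(maximalRealSubfield L))) (γ : (UnitaryGroup.cmDatum L 3 (splitForm L 3)).Local v),
          MeasurableSpace ((UnitaryGroup.cmDatum L 3 (splitForm L 3)).Local v ⧸
            Subgroup.centralizer ({γ} : Set ((UnitaryGroup.cmDatum L 3 (splitForm L 3)).Local v))) := fun _ _ => borel _
      Literature.NumberTheory.Rogawski1990.adelicKappaOrbitalSum (Literature.NumberTheory.Rogawski1990.MatchingAdeleG₂.classes L H H γ₀) E'
          (UnitaryGroup.OrbitalMeasureFamily.ofLocalAdelic L 3 H 𝔨.mG 𝔨.mGi) ⇑f' =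
        Literature.NumberTheory.Rogawski1990.adelicKappaOrbitalSum (Literature.NumberTheory.Rogawski1990.MatchingAdeleG.classes L H γ₀) E
          (UnitaryGroup.OrbitalMeasureFamily.ofLocalAdelic L 3 (splitForm L 3) 𝔨.mq 𝔨.mqi) ⇑f) :
    𝔨.J c f' = 𝔨.SJG c f + (1 / 2 : ℂ) * 𝔨.SJHover c fH := by
  have hJ' := 𝔨.J_eq_of_singular hJ hα hμ c γ₀ a b hc hab hγ hchar f'
  have hSS := 𝔨.stableSide_eq_of_singular hTr hS hcs hm c γ₀ a b hc hab ha hb hγ hchar γH h1 h2 mH hSJH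
  rw [hc] at hJ'
  rw [hJ', hSS, hD1, ← hbridge, hstE, ← hκm]
  push_cast
  ring

/-! ## §M1 The singular branch (SIGNED) with `hD1`, `hbridge`, `W∕W′`, `γH`, `mH`, `hfin` DISCHARGED BY NAME -/

section Merged

open Literature.NumberTheory.Rogawski1990

/-- **The transported family inherits class-local admissibility**: if `m^{G′}_v` is admissible on the classes of `U(H)(L⁺_v)` corresponding to `γ′`
(`Corresponds` = `GL₃`-conjugacy, a class function) and `ψ_v` preserves classes (pin (x)), then `m_v = (ψ_v)_* m^{G′}_v` (the kit's `mq`) is admissible on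
the classes of `U(Φ₃)(L⁺_v)` corresponding to `γ′` (★ `OrbitalMeasureFamily.IsAdmissibleOn.transport`). [cite: Rogawski1990, §14.2 (14.2.1) p. 232]
[cite: Gelbart1975, §10 pp. 154–155] -/
theorem isAdmissibleOn_mq_of_isAdmissibleOn_mG
    (hcl : ∀ (v : HeightOneSpectrum (𝓞 ↥(maximalRealSubfield L))) (γ' : (UnitaryGroup.cmDatum L 3 H).Local v),
      Corresponds (UnitaryGroup.conjLocal L (IsCMField.complexConj L) v)
        ((UnitaryGroup.adelicForm L 3 H).map (UnitaryGroup.adeleToLocal L v))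
        ((UnitaryGroup.adelicForm L 3 (splitForm L 3)).map (UnitaryGroup.adeleToLocal L v)) γ' (𝔨.ψ v γ'))
    (v : HeightOneSpectrum (𝓞 ↥(maximalRealSubfield L))) (γ' : (UnitaryGroup.cmDatum L 3 H).Local v)
    (hadm : letI : ∀ (v : HeightOneSpectrum (𝓞 ↥(maximalRealSubfield L))) (x : (UnitaryGroup.cmDatum L 3 H).Local v),
        MeasurableSpace ((UnitaryGroup.cmDatum L 3 H).Local v ⧸ Subgroup.centralizer ({x} : Set ((UnitaryGroup.cmDatum L 3 H).Local v))) := fun _ _ => borel _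
      (𝔨.mG v).IsAdmissibleOn fun x : (UnitaryGroup.cmDatum L 3 H).Local v =>
        Corresponds (UnitaryGroup.conjLocal L (IsCMField.complexConj L) v)
          ((UnitaryGroup.adelicForm L 3 H).map (UnitaryGroup.adeleToLocal L v))
          ((UnitaryGroup.adelicForm L 3 H).map (UnitaryGroup.adeleToLocal L v)) γ' x) :
    letI : ∀ (v : HeightOneSpectrum (𝓞 ↥(maximalRealSubfield L))) (x : (UnitaryGroup.cmDatum L 3 (splitForm L 3)).Local v),
        MeasurableSpace ((UnitaryGroup.cmDatum L 3 (splitForm L 3)).Local v ⧸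
          Subgroup.centralizer ({x} : Set ((UnitaryGroup.cmDatum L 3 (splitForm L 3)).Local v))) := fun _ _ => borel _
    (𝔨.mq v).IsAdmissibleOn fun x : (UnitaryGroup.cmDatum L 3 (splitForm L 3)).Local v =>
      Corresponds (UnitaryGroup.conjLocal L (IsCMField.complexConj L) v)
        ((UnitaryGroup.adelicForm L 3 H).map (UnitaryGroup.adeleToLocal L v))
        ((UnitaryGroup.adelicForm L 3 (splitForm L 3)).map (UnitaryGroup.adeleToLocal L v)) γ' x := by
  letI : ∀ (v : HeightOneSpectrum (𝓞 ↥(maximalRealSubfield L))) (x : (UnitaryGroup.cmDatum L 3 H).Local v),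
      MeasurableSpace ((UnitaryGroup.cmDatum L 3 H).Local v ⧸ Subgroup.centralizer ({x} : Set ((UnitaryGroup.cmDatum L 3 H).Local v))) :=
    fun _ _ => borel _
  haveI : ∀ (v : HeightOneSpectrum (𝓞 ↥(maximalRealSubfield L))) (x : (UnitaryGroup.cmDatum L 3 H).Local v),
      BorelSpace ((UnitaryGroup.cmDatum L 3 H).Local v ⧸ Subgroup.centralizer ({x} : Set ((UnitaryGroup.cmDatum L 3 H).Local v))) :=
    fun _ _ => ⟨rfl⟩
  letI : ∀ (v : HeightOneSpectrum (𝓞 ↥(maximalRealSubfield L))) (x : (UnitaryGroup.cmDatum L 3 (splitForm L 3)).Local v),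
      MeasurableSpace ((UnitaryGroup.cmDatum L 3 (splitForm L 3)).Local v ⧸
        Subgroup.centralizer ({x} : Set ((UnitaryGroup.cmDatum L 3 (splitForm L 3)).Local v))) := fun _ _ => borel _
  haveI : ∀ (v : HeightOneSpectrum (𝓞 ↥(maximalRealSubfield L))) (x : (UnitaryGroup.cmDatum L 3 (splitForm L 3)).Local v),
      BorelSpace ((UnitaryGroup.cmDatum L 3 (splitForm L 3)).Local v ⧸
        Subgroup.centralizer ({x} : Set ((UnitaryGroup.cmDatum L 3 (splitForm L 3)).Local v))) := fun _ _ => ⟨rfl⟩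
  refine hadm.transport (𝔨.ψ v).toMulEquiv (𝔨.ψ v).continuous (𝔨.ψ v).symm.continuous (fun b b' h => ?_) (fun a ha => ?_)
  · have hGL : IsConj (b.val : GL (Fin 3) (UnitaryGroup.LocalRing L v)) b'.val :=
      (UnitaryGroup.«local» L (IsCMField.complexConj L) 3 H v).subtype.map_isConj h
    exact ⟨fun hb => IsConj.trans hb hGL, fun hb' => IsConj.trans hb' hGL.symm⟩
  · have h := hcl v ((𝔨.ψ v).symm a)
    rw [ContinuousMulEquiv.apply_symm_apply] at h
    exact IsConj.trans ha h.symm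

/-- **T1b AT A SINGULAR NON-CENTRAL CLASS (SIGNED currency), numerical inputs discharged BY NAME.**  §S3 `lawT1b_singular_of_pieces` with `hD1 :=` ★ (D1-s) FILE 4 §3
(sign-free count), `hbridge :=` ★ W19-glue `half_adelicKappaOrbitalSum_add_eq_of_forall` (p821926; its `hfin :=` ★ (D1-s) FILE 2, its `hEW` from the product-formula
text `SingularSignProductFormula` through ★ (h5) Hasse `singularObsHasse_of_charpoly_eq`), `W :=` ★ (i)-W-s `exists_singularClassWeight`, `W′ := E′(γ₀) · W`,
`γH := (a•1₂, b•1₁)` (★ T-s), `mH` from the signed mass pin, `hstE` from the signed st-half text, `hnorm′` from `hpin` by ★ (NORM-s) §1.  LEFT at the class: the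
inner-form binders `hadmG′` (ix-adm), `hadmAG′` (ix-admA), `hpin` (ix-norm) and the (xi″) tensor witnesses.  (The v4 G-side plumbing — THINNING A∕B, (x) `hcl`,
(vi) level matching, (ix′) witnesses — moved INTO the pending discharge (L3) of `SingularStableHalfSigned`; `isAdmissibleOn_mq_of_isAdmissibleOn_mG` stays for it.)
[cite: Rogawski1990, §14.5 p. 239; Lemma 14.5.2 (b) p. 238; §5.4 (5.4.1)–(5.4.3) pp. 72–73; §4.1 (4.1.2); Prop. 10.1.2 p. 146] [cite: Kottwitz1986, §9] [cite: Kottwitz1988, Thm. 1] -/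
theorem lawT1b_singular_of_pins {E' : ConjClasses (GpAdelic L H) → ℂ}
    {E : ConjClasses (GAdelic L) → ℂ}
    (hherm : IsHermitianCM L H) (hanis : IsAnisotropic L H)
    (hJ : letI : ∀ g : GpAdelic L H, MeasurableSpace (GpAdelic L H ⧸ Subgroup.centralizer ({g} : Set (GpAdelic L H))) := fun _ => borel _
      ∀ (c : 𝔨.StClass) (f' : TestGp L H),
        𝔨.J c f' = (𝔨.eSt c).orbitalSum (UnitaryGroup.adelicClassOrbitalIntegral L 3 H 𝔨.μA f'))
    (hα : ∀ c : 𝔨.StClass, 0 < 𝔨.α c) (hTr : 𝔨.PinTransfersTo 𝔨.eStH)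
    (hS : 𝔨.PinSJGSingularSigned E) (hμ : 𝔨.PinMuAShapeSingular) (hcs : 𝔨.PinSingularHRegularVanish)
    (hEM : 𝔨.PinSingularEndoscopicMass) (hSt : 𝔨.SingularStableHalfSigned E' E) (hRb : SignWeightReadsObs E')
    {f' : TestGp L H} {f : TestG L} {fH : TestH L} (hm : 𝔨.Matches f' f fH)
    -- the (xi″) tensor witnesses of `TransferH f′ f^H`, with `T₂` a TEST tensor
    (T₂ : UnitaryGroup.PureTensor L 3 H) (TH : UnitaryGroup.PureTensor₂ L (splitForm L 2) (splitForm L 1)) (hT₂ : T₂.IsTest)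
    (hfT₂ : ⇑f' = T₂.eval) (hfHT : ⇑fH = TH.eval)
    -- the class
    (c : 𝔨.StClass) (γ₀ : (UnitaryGroup.cmDatum L 3 H).Rational) (a b : L)
    (hc : 𝔨.eSt c = stableClassOf (cmConjRingHom L) H γ₀) (hab : a ≠ b)
    (ha : cmConjRingHom L a * a = 1) (hb : cmConjRingHom L b * b = 1)
    (hγ : (((γ₀.val : GL (Fin 3) L) : Matrix (Fin 3) (Fin 3) L) - a • (1 : Matrix (Fin 3) (Fin 3) L)) *
      (((γ₀.val : GL (Fin 3) L) : Matrix (Fin 3) (Fin 3) L) - b • (1 : Matrix (Fin 3) (Fin 3) L)) = 0)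
    (hchar : ((γ₀.val : GL (Fin 3) L) : Matrix (Fin 3) (Fin 3) L).charpoly = (X - C a) ^ 2 * (X - C b))
    -- kit-side binders on the inner form `G′ = U(H)` at `γ₀`: (ix-adm), (ix-admA), (ix-norm)
    (hadmG' : letI : ∀ (v : HeightOneSpectrum (𝓞 ↥(maximalRealSubfield L))) (x : (UnitaryGroup.cmDatum L 3 H).Local v),
        MeasurableSpace ((UnitaryGroup.cmDatum L 3 H).Local v ⧸ Subgroup.centralizer ({x} : Set ((UnitaryGroup.cmDatum L 3 H).Local v))) := fun _ _ => borel _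
      ∀ v, (𝔨.mG v).IsAdmissibleOn fun x : (UnitaryGroup.cmDatum L 3 H).Local v =>
        Corresponds (UnitaryGroup.conjLocal L (IsCMField.complexConj L) v)
          ((UnitaryGroup.adelicForm L 3 H).map (UnitaryGroup.adeleToLocal L v))
          ((UnitaryGroup.adelicForm L 3 H).map (UnitaryGroup.adeleToLocal L v))
          ((UnitaryGroup.cmDatum L 3 H).toLocal v ((UnitaryGroup.cmDatum L 3 H).toAdelic γ₀)) x)
    (hadmAG' : letI : ∀ γ : GpInf L H, MeasurableSpace (GpInf L H ⧸ Subgroup.centralizer ({γ} : Set (GpInf L H))) := fun _ => borel _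
      𝔨.mGi.IsAdmissibleOn fun x : UnitaryGroup.arch (↥(maximalRealSubfield L)) L (IsCMField.complexConj L) 3 H =>
        Corresponds (UnitaryGroup.conjMixed (↥(maximalRealSubfield L)) L (IsCMField.complexConj L)) (UnitaryGroup.archFormOf L 3 H)
          (UnitaryGroup.archFormOf L 3 H) (cmRationalToArch L 3 H γ₀) x)
    (hpin : letI : ∀ (v : HeightOneSpectrum (𝓞 ↥(maximalRealSubfield L))) (x : (UnitaryGroup.cmDatum L 3 H).Local v),
        MeasurableSpace ((UnitaryGroup.cmDatum L 3 H).Local v ⧸ Subgroup.centralizer ({x} : Set ((UnitaryGroup.cmDatum L 3 H).Local v))) := fun _ _ => borel _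
      ∃ S₀ : Finset (HeightOneSpectrum (𝓞 ↥(maximalRealSubfield L))),
        UnitaryGroup.IsNormalisedOff L 3 H 𝔨.mG ((UnitaryGroup.cmDatum L 3 H).toAdelic γ₀) S₀) :
    𝔨.J c f' = 𝔨.SJG c f + (1 / 2 : ℂ) * 𝔨.SJHover c fH := by
  letI : ∀ g : GpAdelic L H, MeasurableSpace (GpAdelic L H ⧸ Subgroup.centralizer ({g} : Set (GpAdelic L H))) := fun _ => borel _
  letI : ∀ γ : GpInf L H, MeasurableSpace (GpInf L H ⧸ Subgroup.centralizer ({γ} : Set (GpInf L H))) := fun _ => borel _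
  letI : ∀ (v : HeightOneSpectrum (𝓞 ↥(maximalRealSubfield L))) (γ : (UnitaryGroup.cmDatum L 3 H).Local v),
      MeasurableSpace ((UnitaryGroup.cmDatum L 3 H).Local v ⧸
        Subgroup.centralizer ({γ} : Set ((UnitaryGroup.cmDatum L 3 H).Local v))) := fun _ _ => borel _
  letI : ∀ g : GAdelic L, MeasurableSpace (GAdelic L ⧸ Subgroup.centralizer ({g} : Set (GAdelic L))) := fun _ => borel _
  letI : ∀ γ : GInf L, MeasurableSpace (GInf L ⧸ Subgroup.centralizer ({γ} : Set (GInf L))) := fun _ => borel _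
  letI : ∀ (v : HeightOneSpectrum (𝓞 ↥(maximalRealSubfield L))) (γ : (UnitaryGroup.cmDatum L 3 (splitForm L 3)).Local v),
      MeasurableSpace ((UnitaryGroup.cmDatum L 3 (splitForm L 3)).Local v ⧸
        Subgroup.centralizer ({γ} : Set ((UnitaryGroup.cmDatum L 3 (splitForm L 3)).Local v))) := fun _ _ => borel _
  haveI : ∀ g : GpAdelic L H, BorelSpace (GpAdelic L H ⧸ Subgroup.centralizer ({g} : Set (GpAdelic L H))) := fun _ => ⟨rfl⟩
  haveI : ∀ γ : GpInf L H, BorelSpace (GpInf L H ⧸ Subgroup.centralizer ({γ} : Set (GpInf L H))) := fun _ => ⟨rfl⟩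
  haveI : ∀ (v : HeightOneSpectrum (𝓞 ↥(maximalRealSubfield L))) (γ : (UnitaryGroup.cmDatum L 3 H).Local v),
      BorelSpace ((UnitaryGroup.cmDatum L 3 H).Local v ⧸
        Subgroup.centralizer ({γ} : Set ((UnitaryGroup.cmDatum L 3 H).Local v))) := fun _ _ => ⟨rfl⟩
  have hdet : H.det ≠ 0 := Literature.NumberTheory.Automorphic.Godement.det_ne_zero_of_anisotropic L H hanis
  have hnc := not_exists_coe_eq_smul_one_of_charpoly_eq hab hchar
  -- the singular Hasse principle at `γ₀` (★ (h5) `MatchingAdeleG₂.singularObsHasse_of_charpoly_eq`)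
  have hHasse := MatchingAdeleG₂.singularObsHasse_of_charpoly_eq hherm hdet hanis hab hγ hchar
  -- `γH = (a•1₂, b•1₁)` (★ T-s); the κ-weight of ★ (D1-s) is READ AS THE SIGN: `W := E′` by the (d) text
  obtain ⟨γH, h1, h2, -⟩ := exists_transfersTo_fst_eq_smul_one (cmConjRingHom L) endoForm_antidiagOne γ₀ hab ha hb hγ hchar
  have hW : ∀ q : MatchingAdeleG₂ L H H γ₀, E' (ConjClasses.mk q.adele) = if q.singularObs hab hγ = 0 then 1 else -1 :=
    hRb γ₀ a b hab ha hb hγ hnc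
  -- normalisation at every matching adèle from the pin (★ (NORM-s) §1)
  have hnormG' := MatchingAdeleG₂.forall_exists_isNormalisedOff_of_mul_sub_eq_zero hherm hdet
    (corresponds_self_iff.2 (IsStablyConj.refl γ₀)) hab hγ 𝔨.mG hadmG' hpin
  -- `hD1` (★ (D1-s) FILE 4 §3) at the test tensor `T₂` of `f′`, with `W := E′`
  have hD1 := adelicStableOrbitalIntegral_ofLocal_stableClassOf_eq_half_of_singularObs hherm hanis hab hγ hHasse E' hW 𝔨.mG 𝔨.mGi
    hadmG' hadmAG' hpin hnormG' T₂ hT₂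
  have hbridge :
      (1 / 2 : ℂ) * (adelicKappaOrbitalSum (MatchingAdeleG₂.classes L H H γ₀) E'
            (UnitaryGroup.OrbitalMeasureFamily.ofLocalAdelic L 3 H 𝔨.mG 𝔨.mGi) T₂.eval +
          adelicKappaOrbitalSum (MatchingAdeleG₂.classes L H H γ₀) (fun _ => (1 : ℂ))
            (UnitaryGroup.OrbitalMeasureFamily.ofLocalAdelic L 3 H 𝔨.mG 𝔨.mGi) T₂.eval) =
        (1 / 2 : ℂ) * (adelicStableOrbitalSum (MatchingAdeleG₂.classes L H H γ₀)
            (UnitaryGroup.OrbitalMeasureFamily.ofLocalAdelic L 3 H 𝔨.mG 𝔨.mGi) T₂.eval +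
          adelicKappaOrbitalSum (MatchingAdeleG₂.classes L H H γ₀) E'
            (UnitaryGroup.OrbitalMeasureFamily.ofLocalAdelic L 3 H 𝔨.mG 𝔨.mGi) T₂.eval) := by
    rw [adelicKappaOrbitalSum_one]; ring
  rw [← hfT₂] at hD1 hbridge
  -- the signed st-half (text (L3)) and the signed mass pin at `(𝒪, γ₀, a, b, γH, 𝒪′_st(γH))`
  have hnreg : ¬ IsRegularElt (γ₀.val : GL (Fin 3) L) := fun h => by
    have hsep := (isRegularElt_iff _).1 h
    rw [hchar] at hsep
    exact absurd (Polynomial.Separable.of_pow (Polynomial.not_isUnit_X_sub_C a) two_ne_zero hsep.of_mul_left).2 (by norm_num)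
  have hstE := hSt f' f hm.1 γ₀ a b hab ha hb hγ hnc hnreg
  have hcH : 𝔨.eStH (𝔨.eStH.symm (stableClassHOf (cmConjRingHom L) (splitForm L 2) (splitForm L 1) γH)) =
      stableClassHOf (cmConjRingHom L) (splitForm L 2) (splitForm L 1) γH := Equiv.apply_symm_apply _ _
  have htH : 𝔨.transfersTo (𝔨.eStH.symm (stableClassHOf (cmConjRingHom L) (splitForm L 2) (splitForm L 1) γH)) c := by
    rw [hTr, hcH, hc]
    exact transfersTo_mk_of_fst_eq_smul_one (cmConjRingHom L) endoForm_antidiagOne hab hγ hchar γH h1 h2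
  obtain ⟨mH, hSJH, hκm⟩ := hEM c γ₀ a b hc hab hγ hnc γH h1 h2 _ hcH htH
  have hk := hκm f' fH hm.2 T₂ TH hfT₂ hfHT
  rw [← adelicKappaOrbitalSum_one, ← hfT₂, ← hfHT] at hk
  exact 𝔨.lawT1b_singular_of_pieces hJ hα hTr hS hμ hcs hm c γ₀ a b hc hab ha hb hγ hchar γH h1 h2 E' (fun _ => (1 : ℂ)) mH hSJH hk
    hD1 hbridge hstE

/-! ## §M2 THE MERGED CLOSER `lawT1bNonreg_of_pins : … → 𝔨.LawT1bNonreg` (central ∨ singular), SIGNED currency over abstract signs `E′ ∕ E` -/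

/-- **T1b AT THE NON-REGULAR STABLE CLASSES — the ED ≥ 1.24 API closer in W19 signed currency (v5-pre).**  For the anisotropic hermitian `H`, every `γ₀` is
semisimple (★ `isSemisimpleElt_of_anisotropic`), so a NON-regular stable class is (★ `singular_semisimple_dichotomy`) CENTRAL — §C1 `lawT1b_central_of_pins`
[Prop. 10.1.2 (b)(2); Lemma 14.5.2 (c)] — or SINGULAR with `charpoly γ₀ = (X − a)²(X − b)` — §M1 `lawT1b_singular_of_pins` [§14.5 p. 239; Lemma 14.5.2 (a)(b)].
Hypotheses beyond the pins: the three inner-form family texts (ix-adm)∕(ix-admA)∕(ix-norm) guarded by `¬ IsRegularElt γ₀`, the (xi″) tensor clause (`T` a TEST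
tensor, as `IsPinned.deltaTransfer_tensors` delivers), the signed st-half text `SingularStableHalfSigned E′ E` ((L3), ★-pending) and the product-formula text
`SingularSignProductFormula E′` ((L2), ★-pending `KottwitzSign`).
[cite: Rogawski1990, §14.5 pp. 238–239; Lemma 14.5.2 p. 238; Prop. 10.1.2 p. 146; §3.8 Prop. 3.8.1 (a) p. 27; §4.1 (4.1.2)] [cite: Kottwitz1986, §9] [cite: Kottwitz1988, Thm. 1] -/
theorem lawT1bNonreg_of_pins {E' : ConjClasses (GpAdelic L H) → ℂ}
    {E : ConjClasses (GAdelic L) → ℂ}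
    (hherm : IsHermitianCM L H) (hanis : IsAnisotropic L H)
    -- MAIN pins (viii″), (xiii-c) and `0 < α`
    (hJ : letI : ∀ g : GpAdelic L H, MeasurableSpace (GpAdelic L H ⧸ Subgroup.centralizer ({g} : Set (GpAdelic L H))) := fun _ => borel _
      ∀ (c : 𝔨.StClass) (f' : TestGp L H),
        𝔨.J c f' = (𝔨.eSt c).orbitalSum (UnitaryGroup.adelicClassOrbitalIntegral L 3 H 𝔨.μA f'))
    (hα : ∀ c : 𝔨.StClass, 0 < 𝔨.α c) (hTr : 𝔨.PinTransfersTo 𝔨.eStH)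
    -- the central-class pins (SPEC-O7 v2.1 §A∕§C; sign-free)
    (hC : 𝔨.PinSJGCentral) (hHi : 𝔨.PinSJHCentralImage) (hmass : 𝔨.PinMuAMassCentral) (hcc : 𝔨.PinCentralHVanish)
    (hdc : 𝔨.PinCentralValueTransfer)
    -- the singular-class pins, SIGNED where they read values (RULING #116)
    (hS : 𝔨.PinSJGSingularSigned E) (hμ : 𝔨.PinMuAShapeSingular) (hcs : 𝔨.PinSingularHRegularVanish)
    (hEM : 𝔨.PinSingularEndoscopicMass) (hSt : 𝔨.SingularStableHalfSigned E' E) (hRb : SignWeightReadsObs E')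
    -- pin (xi″) unpacked: tensor witnesses of `TransferH`, `T` a TEST tensor
    (htensH : ∀ (f' : TestGp L H) (fH : TestH L), 𝔨.TransferH f' fH →
      ∃ (T : UnitaryGroup.PureTensor L 3 H) (TH : UnitaryGroup.PureTensor₂ L (splitForm L 2) (splitForm L 1)),
        T.IsTest ∧ ⇑f' = T.eval ∧ ⇑fH = TH.eval)
    -- (ix-adm)∕(ix-admA)∕(ix-norm) texts, inner form `G′ = U(H)`, at the NON-REGULAR rational classes
    (hadmG' : letI : ∀ (v : HeightOneSpectrum (𝓞 ↥(maximalRealSubfield L))) (x : (UnitaryGroup.cmDatum L 3 H).Local v),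
        MeasurableSpace ((UnitaryGroup.cmDatum L 3 H).Local v ⧸ Subgroup.centralizer ({x} : Set ((UnitaryGroup.cmDatum L 3 H).Local v))) := fun _ _ => borel _
      ∀ γ₀ : (UnitaryGroup.cmDatum L 3 H).Rational, ¬ IsRegularElt (γ₀.val : GL (Fin 3) L) →
      ∀ v, (𝔨.mG v).IsAdmissibleOn fun x : (UnitaryGroup.cmDatum L 3 H).Local v =>
        Corresponds (UnitaryGroup.conjLocal L (IsCMField.complexConj L) v)
          ((UnitaryGroup.adelicForm L 3 H).map (UnitaryGroup.adeleToLocal L v))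
          ((UnitaryGroup.adelicForm L 3 H).map (UnitaryGroup.adeleToLocal L v))
          ((UnitaryGroup.cmDatum L 3 H).toLocal v ((UnitaryGroup.cmDatum L 3 H).toAdelic γ₀)) x)
    (hadmAG' : letI : ∀ γ : GpInf L H, MeasurableSpace (GpInf L H ⧸ Subgroup.centralizer ({γ} : Set (GpInf L H))) := fun _ => borel _
      ∀ γ₀ : (UnitaryGroup.cmDatum L 3 H).Rational, ¬ IsRegularElt (γ₀.val : GL (Fin 3) L) →
      𝔨.mGi.IsAdmissibleOn fun x : UnitaryGroup.arch (↥(maximalRealSubfield L)) L (IsCMField.complexConj L) 3 H =>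
        Corresponds (UnitaryGroup.conjMixed (↥(maximalRealSubfield L)) L (IsCMField.complexConj L)) (UnitaryGroup.archFormOf L 3 H)
          (UnitaryGroup.archFormOf L 3 H) (cmRationalToArch L 3 H γ₀) x)
    (hpin : letI : ∀ (v : HeightOneSpectrum (𝓞 ↥(maximalRealSubfield L))) (x : (UnitaryGroup.cmDatum L 3 H).Local v),
        MeasurableSpace ((UnitaryGroup.cmDatum L 3 H).Local v ⧸ Subgroup.centralizer ({x} : Set ((UnitaryGroup.cmDatum L 3 H).Local v))) := fun _ _ => borel _
      ∀ γ₀ : (UnitaryGroup.cmDatum L 3 H).Rational, ¬ IsRegularElt (γ₀.val : GL (Fin 3) L) →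
      ∃ S₀ : Finset (HeightOneSpectrum (𝓞 ↥(maximalRealSubfield L))),
        UnitaryGroup.IsNormalisedOff L 3 H 𝔨.mG ((UnitaryGroup.cmDatum L 3 H).toAdelic γ₀) S₀) :
    𝔨.LawT1bNonreg := by
  intro f' f fH hm c hnreg
  have hdet : H.det ≠ 0 := Literature.NumberTheory.Automorphic.Godement.det_ne_zero_of_anisotropic L H hanis
  obtain ⟨γ₀, hγ₀⟩ := stableClassOf_surjective (𝔨.eSt c)
  have hc : 𝔨.eSt c = stableClassOf (cmConjRingHom L) H γ₀ := hγ₀.symm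
  have hnreg' : ¬ IsRegularElt (γ₀.val : GL (Fin 3) L) := fun h => hnreg (StableClass.isRegular_of_eq_stableClassOf hc h)
  have hss : IsSemisimpleElt (cmConjRingHom L) H γ₀ := isSemisimpleElt_of_anisotropic (cmConjRingHom L) H hanis γ₀
  rcases singular_semisimple_dichotomy (cmConjRingHom L) (IsCMField.complexConj_apply_apply L) hherm hdet γ₀ hss hnreg' with
    ⟨ζ, -, hζ⟩ | ⟨a, b, hab, ha, hb, hγ, hchar⟩
  · exact 𝔨.lawT1b_central_of_pins hdet hJ hα hTr hC hHi hmass hcc hdc hm c γ₀ ζ hc hζ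
  · obtain ⟨T₂, TH, hT₂, hfT₂, hfHT⟩ := htensH f' fH hm.2
    exact 𝔨.lawT1b_singular_of_pins hherm hanis hJ hα hTr hS hμ hcs hEM hSt hRb hm T₂ TH hT₂ hfT₂ hfHT c γ₀ a b hc hab ha hb hγ hchar
      (hadmG' γ₀ hnreg') (hadmAG' γ₀ hnreg') (hpin γ₀ hnreg')


/-! ## §M3 (L3) DISCHARGE of the signed st-half text from ★-pending (SA-st-w) `AdelicInnerTransferWeighted` (A-p01 (g16)) + pins, over ABSTRACT weight data -/

/-- **(E-fac′) THE INNER-FORM ADELIC SIGN IS EULER** (text over abstract local ∕ archimedean class weights `wloc′ v`, `warch′`, read on the MATCHING classes `𝒞′_𝐀(γ₀)` of a split-singular `γ₀` only — A-p18 (g20) 12:27:03Z FINDING: over all adelic classes it would be unsatisfiable: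
`E′(c) = warch′([c_∞]) · ∏_{v ∈ S_w(c)} wloc′_v([c_v])`, `wloc′_v([c_v]) = 1` off `S_w(c)` — A-p18 (g20)'s `kottwitzSignAdelic := e_∞ · ∏ᶠ_v e_v` + finite support;
= (SA-st-w)'s binder `hwE′`). [Rogawski1990, §4.1 (4.1.2) pp. 39–40] [Kottwitz1986, §9] -/
def SignWeightIsEuler (E' : ConjClasses (GpAdelic L H) → ℂ)
    (wloc' : ∀ v : HeightOneSpectrum (𝓞 ↥(maximalRealSubfield L)), ConjClasses ((UnitaryGroup.cmDatum L 3 H).Local v) → ℂ)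
    (warch' : ConjClasses (GpInf L H) → ℂ) : Prop :=
  ∀ (γ₀ : (UnitaryGroup.cmDatum L 3 H).Rational) (a b : L), a ≠ b → cmConjRingHom L a * a = 1 → cmConjRingHom L b * b = 1 →
    (((γ₀.val : GL (Fin 3) L) : Matrix (Fin 3) (Fin 3) L) - a • (1 : Matrix (Fin 3) (Fin 3) L)) *
      (((γ₀.val : GL (Fin 3) L) : Matrix (Fin 3) (Fin 3) L) - b • (1 : Matrix (Fin 3) (Fin 3) L)) = 0 →
    (¬ ∃ ζ : L, ((γ₀.val : GL (Fin 3) L) : Matrix (Fin 3) (Fin 3) L) = ζ • (1 : Matrix (Fin 3) (Fin 3) L)) →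
  ∀ c ∈ Literature.NumberTheory.Rogawski1990.MatchingAdeleG₂.classes L H H γ₀, ∃ Sw : Finset (HeightOneSpectrum (𝓞 ↥(maximalRealSubfield L))),
    (∀ v ∉ Sw, wloc' v (ConjClasses.mk ((UnitaryGroup.cmDatum L 3 H).toLocal v (Quotient.out c))) = 1) ∧
    E' c = warch' (ConjClasses.mk (UnitaryGroup.archPart (↥(maximalRealSubfield L)) L (IsCMField.complexConj L) 3 H (Quotient.out c))) *
      ∏ v ∈ Sw, wloc' v (ConjClasses.mk ((UnitaryGroup.cmDatum L 3 H).toLocal v (Quotient.out c)))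

variable (H) in
/-- **(E-fac) THE QUASI-SPLIT ADELIC SIGN IS EULER** (same text on the quasi-split carrier `𝒞_𝐀(γ₀)`; = (SA-st-w)'s `hwE`). [Rogawski1990, §4.1 (4.1.2) pp. 39–40] -/
def SignWeightIsEulerG (E : ConjClasses (GAdelic L) → ℂ)
    (wloc : ∀ v : HeightOneSpectrum (𝓞 ↥(maximalRealSubfield L)), ConjClasses ((UnitaryGroup.cmDatum L 3 (splitForm L 3)).Local v) → ℂ)
    (warch : ConjClasses (GInf L) → ℂ) : Prop :=
  ∀ (γ₀ : (UnitaryGroup.cmDatum L 3 H).Rational) (a b : L), a ≠ b → cmConjRingHom L a * a = 1 → cmConjRingHom L b * b = 1 →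
    (((γ₀.val : GL (Fin 3) L) : Matrix (Fin 3) (Fin 3) L) - a • (1 : Matrix (Fin 3) (Fin 3) L)) *
      (((γ₀.val : GL (Fin 3) L) : Matrix (Fin 3) (Fin 3) L) - b • (1 : Matrix (Fin 3) (Fin 3) L)) = 0 →
    (¬ ∃ ζ : L, ((γ₀.val : GL (Fin 3) L) : Matrix (Fin 3) (Fin 3) L) = ζ • (1 : Matrix (Fin 3) (Fin 3) L)) →
  ∀ c ∈ Literature.NumberTheory.Rogawski1990.MatchingAdeleG.classes L H γ₀, ∃ Sw : Finset (HeightOneSpectrum (𝓞 ↥(maximalRealSubfield L))),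
    (∀ v ∉ Sw, wloc v (ConjClasses.mk ((UnitaryGroup.cmDatum L 3 (splitForm L 3)).toLocal v (Quotient.out c))) = 1) ∧
    E c = warch (ConjClasses.mk (UnitaryGroup.archPart (↥(maximalRealSubfield L)) L (IsCMField.complexConj L) 3 (splitForm L 3) (Quotient.out c))) *
      ∏ v ∈ Sw, wloc v (ConjClasses.mk ((UnitaryGroup.cmDatum L 3 (splitForm L 3)).toLocal v (Quotient.out c)))

/-- **(E-one′) the local signs of a split-singular RATIONAL inner-form point are `1` almost everywhere** (= (SA-st-w)'s `hw1′`; ★-pending `eventually_kottwitzSignLocal_toAdelic_eq_one`, A-p18 FILE 7). [Rogawski1990, §4.1 (4.1.2)] -/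
def SignWeightLocTrivialAE
    (wloc' : ∀ v : HeightOneSpectrum (𝓞 ↥(maximalRealSubfield L)), ConjClasses ((UnitaryGroup.cmDatum L 3 H).Local v) → ℂ) : Prop :=
  ∀ (γ₀ : (UnitaryGroup.cmDatum L 3 H).Rational) (a b : L), a ≠ b → cmConjRingHom L a * a = 1 → cmConjRingHom L b * b = 1 →
    (((γ₀.val : GL (Fin 3) L) : Matrix (Fin 3) (Fin 3) L) - a • (1 : Matrix (Fin 3) (Fin 3) L)) *
      (((γ₀.val : GL (Fin 3) L) : Matrix (Fin 3) (Fin 3) L) - b • (1 : Matrix (Fin 3) (Fin 3) L)) = 0 →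
    (¬ ∃ ζ : L, ((γ₀.val : GL (Fin 3) L) : Matrix (Fin 3) (Fin 3) L) = ζ • (1 : Matrix (Fin 3) (Fin 3) L)) →
    ∀ᶠ v in Filter.cofinite, wloc' v (ConjClasses.mk ((UnitaryGroup.cmDatum L 3 H).toLocal v ((UnitaryGroup.cmDatum L 3 H).toAdelic γ₀))) = 1

variable (H) in
/-- **(E-one) the local signs of the quasi-split CORRESPONDENT of a split-singular rational point are `1` almost everywhere** (= (SA-st-w)'s `hw1`; same ★-pending letter at `H := Φ₃`, `(γ−a)(γ−b) = 0` by ★ `mul_sub_smul_mul_sub_smul_eq_zero_of_isConj`). [Rogawski1990, §4.1 (4.1.2)] -/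
def SignWeightLocTrivialAEG
    (wloc : ∀ v : HeightOneSpectrum (𝓞 ↥(maximalRealSubfield L)), ConjClasses ((UnitaryGroup.cmDatum L 3 (splitForm L 3)).Local v) → ℂ) : Prop :=
  ∀ (γ₀ : (UnitaryGroup.cmDatum L 3 H).Rational) (a b : L), a ≠ b → cmConjRingHom L a * a = 1 → cmConjRingHom L b * b = 1 →
    (((γ₀.val : GL (Fin 3) L) : Matrix (Fin 3) (Fin 3) L) - a • (1 : Matrix (Fin 3) (Fin 3) L)) *
      (((γ₀.val : GL (Fin 3) L) : Matrix (Fin 3) (Fin 3) L) - b • (1 : Matrix (Fin 3) (Fin 3) L)) = 0 →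
    (¬ ∃ ζ : L, ((γ₀.val : GL (Fin 3) L) : Matrix (Fin 3) (Fin 3) L) = ζ • (1 : Matrix (Fin 3) (Fin 3) L)) →
  ∀ γ : (UnitaryGroup.cmDatum L 3 (splitForm L 3)).Rational,
    Literature.NumberTheory.Rogawski1990.Corresponds (cmConjRingHom L) H (splitForm L 3) γ₀ γ →
    ∀ᶠ v in Filter.cofinite,
      wloc v (ConjClasses.mk ((UnitaryGroup.cmDatum L 3 (splitForm L 3)).toLocal v ((UnitaryGroup.cmDatum L 3 (splitForm L 3)).toAdelic γ))) = 1

-- (`PinPsiConj` is declared by the MAIN ∕ API workfile with this very text — consumed BY NAME.)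

/-- **(vii-e) PIN TEXT — the kit's `ψ_v` PRESERVE the local Kottwitz signs** (O7 OWNER WORD #24 (R-d); anchored by A-p18 (g20)'s
`kottwitzSign_congr` ∕ `kottwitzSignLocal_map_cmDatumLocalNonsplitCongr` at MAIN's `ψ₀ := cmDatumLocalNonsplitCongr …`; = (SA-st-w)'s `hwψ`).
[Rogawski1990, §4.1 (4.1.2); §14.1 p. 232] -/
def PinSignTransport
    (wloc' : ∀ v : HeightOneSpectrum (𝓞 ↥(maximalRealSubfield L)), ConjClasses ((UnitaryGroup.cmDatum L 3 H).Local v) → ℂ)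
    (wloc : ∀ v : HeightOneSpectrum (𝓞 ↥(maximalRealSubfield L)), ConjClasses ((UnitaryGroup.cmDatum L 3 (splitForm L 3)).Local v) → ℂ) : Prop :=
  ∀ (v : HeightOneSpectrum (𝓞 ↥(maximalRealSubfield L))) (x : (UnitaryGroup.cmDatum L 3 H).Local v),
    wloc v (ConjClasses.mk (𝔨.ψ v x)) = wloc' v (ConjClasses.mk x)

/-- **(b-s arch, SIGNED) THE ARCHIMEDEAN INNER TRANSFER AT A SPLIT SEMISIMPLE CLASS, weighted form** (SPEC v2.3b text over abstract archimedean weights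
`warch′ ∕ warch`, RULING #116: both sides `kottwitzSignArchWeight`-weighted; binders = v2.2 `PinSingularArchInnerTransfer` (the (ix′) arch datum
`IsArchInnerTransfer L H mGi mqi T.arch T′.arch` at a correspondence `γ₀ ↔ γ`, v6.3: behind the two `ArchSmooth` antecedents of ★ SETC's (ST-∞) clause —
F0P3a-p06 (g5) 13:13:04Z ∕ O7 WORD #54 (1), discharged at the call site by `hT.isArchTest`, `hT′.isArchTest` (★ `archSmooth_arch_iff_isArchTest` is `Iff.rfl`)),
conclusion in (SA-st-w)'s `f^w`-form `harchW` (= A-p06 (g21)'s (ST-∞) clause); MAIN ED 1.24b `PinSingularArchInnerTransfer` = this text AT the Kottwitz weights (δ).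
[Rogawski1990, §14.2 (14.2.1) p. 232; Lemma 14.5.2 (b) p. 238; §4.1 (4.1.2)] [Kottwitz1988, Prop. 2] -/
def PinSingularArchInnerTransferSigned (warch' : ConjClasses (GpInf L H) → ℂ) (warch : ConjClasses (GInf L) → ℂ) : Prop :=
  letI : ∀ γ : GpInf L H, MeasurableSpace (GpInf L H ⧸ Subgroup.centralizer ({γ} : Set (GpInf L H))) := fun _ => borel _
  letI : ∀ γ : GInf L, MeasurableSpace (GInf L ⧸ Subgroup.centralizer ({γ} : Set (GInf L))) := fun _ => borel _
  ∀ (T : UnitaryGroup.PureTensor L 3 H) (T' : UnitaryGroup.PureTensor L 3 (splitForm L 3)),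
    Literature.NumberTheory.Rogawski1990.ArchSmooth L 3 H T.arch → Literature.NumberTheory.Rogawski1990.ArchSmooth L 3 (splitForm L 3) T'.arch →
    Literature.NumberTheory.Rogawski1990.IsArchInnerTransfer L H 𝔨.mGi 𝔨.mqi T.arch T'.arch →
    ∀ (γ₀ : (UnitaryGroup.cmDatum L 3 H).Rational) (γ : (UnitaryGroup.cmDatum L 3 (splitForm L 3)).Rational) (a b : L),
      Literature.NumberTheory.Rogawski1990.Corresponds (cmConjRingHom L) H (splitForm L 3) γ₀ γ →
      a ≠ b →
      (((γ₀.val : GL (Fin 3) L) : Matrix (Fin 3) (Fin 3) L) - a • (1 : Matrix (Fin 3) (Fin 3) L)) *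
        (((γ₀.val : GL (Fin 3) L) : Matrix (Fin 3) (Fin 3) L) - b • (1 : Matrix (Fin 3) (Fin 3) L)) = 0 →
      Literature.NumberTheory.Rogawski1990.archStableOrbitalIntegral L 3 H 𝔨.mGi (fun x => warch' (ConjClasses.mk x) * T.arch x)
          (Literature.NumberTheory.Rogawski1990.cmRationalToArch L 3 H γ₀) =
        Literature.NumberTheory.Rogawski1990.archStableOrbitalIntegral L 3 (splitForm L 3) 𝔨.mqi (fun y => warch (ConjClasses.mk y) * T'.arch y)
          (Literature.NumberTheory.Rogawski1990.cmRationalToArch L 3 (splitForm L 3) γ)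

/-- **(L3) THE SIGNED SINGULAR st-HALF FROM THE PINS** — `SingularStableHalfSigned E′ E` DISCHARGED by ★-pending (SA-st-w)
`adelicKappaOrbitalSum_classesSelf_eq_adelicKappaOrbitalIntegralG_of_mul_sub_eq_zero` (A-p01 (g16), `AdelicInnerTransferWeighted` §5) at the (ix′) tensor witnesses of
each transfer pair, with v4's G-side plumbing back in place: THINNING A (`isAdmissibleOn_mq_of_isAdmissibleOn_mG` + pin (x) `hcl`), THINNING B (★ (NORM-s) §1∕§3 with pin
(vi) `S₀ hψK`), a rational correspondent (★ `exists_corresponds_antidiagThree_all`), `hmq := fun _ => rfl`; the weight data enter as the texts (E-fac′)(E-fac)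
(E-one′)(E-one), the sign-transport pin (vii-e) and the signed arch pin.  Survivors per non-regular `γ₀`: `hadmG′`, `hadmAG′`, `hpin`, `hadmAG` (WORD #20's four).
[cite: Rogawski1990, §14.2 (14.2.1) p. 232; Lemma 14.5.2 (b) p. 238; §5.4 (5.4.3) pp. 72–73; §4.1 (4.1.2)] [cite: Kottwitz1988, Prop. 2] [cite: Kottwitz1986, Prop. 7.1] -/
theorem singularStableHalfSigned_of_pins {E' : ConjClasses (GpAdelic L H) → ℂ} {E : ConjClasses (GAdelic L) → ℂ}
    {wloc' : ∀ v : HeightOneSpectrum (𝓞 ↥(maximalRealSubfield L)), ConjClasses ((UnitaryGroup.cmDatum L 3 H).Local v) → ℂ}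
    {warch' : ConjClasses (GpInf L H) → ℂ}
    {wloc : ∀ v : HeightOneSpectrum (𝓞 ↥(maximalRealSubfield L)), ConjClasses ((UnitaryGroup.cmDatum L 3 (splitForm L 3)).Local v) → ℂ}
    {warch : ConjClasses (GInf L) → ℂ}
    (hherm : IsHermitianCM L H) (hanis : IsAnisotropic L H)
    -- pin (x): the `ψ_v` preserve classes
    (hcl : ∀ (v : HeightOneSpectrum (𝓞 ↥(maximalRealSubfield L))) (γ' : (UnitaryGroup.cmDatum L 3 H).Local v),
      Corresponds (UnitaryGroup.conjLocal L (IsCMField.complexConj L) v)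
        ((UnitaryGroup.adelicForm L 3 H).map (UnitaryGroup.adeleToLocal L v))
        ((UnitaryGroup.adelicForm L 3 (splitForm L 3)).map (UnitaryGroup.adeleToLocal L v)) γ' (𝔨.ψ v γ'))
    -- pin (ix′) unpacked: tensor witnesses of `Transfer`
    (htens : ∀ (f' : TestGp L H) (f : TestG L), 𝔨.Transfer f' f →
      letI : ∀ γ : GpInf L H, MeasurableSpace (GpInf L H ⧸ Subgroup.centralizer ({γ} : Set (GpInf L H))) := fun _ => borel _
      letI : ∀ γ : GInf L, MeasurableSpace (GInf L ⧸ Subgroup.centralizer ({γ} : Set (GInf L))) := fun _ => borel _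
      ∃ (T : UnitaryGroup.PureTensor L 3 H) (T' : UnitaryGroup.PureTensor L 3 (splitForm L 3)),
        T.IsTest ∧ T'.IsTest ∧ ⇑f' = T.eval ∧ ⇑f = T'.eval ∧ (∀ v, T'.loc v = T.loc v ∘ (𝔨.ψ v).symm) ∧
          IsArchInnerTransfer L H 𝔨.mGi 𝔨.mqi T.arch T'.arch)
    -- pin (vi): the level-matching set of the `ψ_v`
    (S₀ : Finset (HeightOneSpectrum (𝓞 ↥(maximalRealSubfield L))))
    (hψK : ∀ v, v ∉ S₀ → ∀ g, 𝔨.ψ v g ∈ UnitaryGroup.cmLocalIntegralLevel L 3 (splitForm L 3) v ↔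
      g ∈ UnitaryGroup.cmLocalIntegralLevel L 3 H v)
    -- (ix-adm)∕(ix-admA)∕(ix-norm)∕(ix-admAq) at the NON-REGULAR rational classes
    (hadmG' : letI : ∀ (v : HeightOneSpectrum (𝓞 ↥(maximalRealSubfield L))) (x : (UnitaryGroup.cmDatum L 3 H).Local v),
        MeasurableSpace ((UnitaryGroup.cmDatum L 3 H).Local v ⧸ Subgroup.centralizer ({x} : Set ((UnitaryGroup.cmDatum L 3 H).Local v))) := fun _ _ => borel _
      ∀ γ₀ : (UnitaryGroup.cmDatum L 3 H).Rational, ¬ IsRegularElt (γ₀.val : GL (Fin 3) L) →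
      ∀ v, (𝔨.mG v).IsAdmissibleOn fun x : (UnitaryGroup.cmDatum L 3 H).Local v =>
        Corresponds (UnitaryGroup.conjLocal L (IsCMField.complexConj L) v)
          ((UnitaryGroup.adelicForm L 3 H).map (UnitaryGroup.adeleToLocal L v))
          ((UnitaryGroup.adelicForm L 3 H).map (UnitaryGroup.adeleToLocal L v))
          ((UnitaryGroup.cmDatum L 3 H).toLocal v ((UnitaryGroup.cmDatum L 3 H).toAdelic γ₀)) x)
    (hadmAG' : letI : ∀ γ : GpInf L H, MeasurableSpace (GpInf L H ⧸ Subgroup.centralizer ({γ} : Set (GpInf L H))) := fun _ => borel _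
      ∀ γ₀ : (UnitaryGroup.cmDatum L 3 H).Rational, ¬ IsRegularElt (γ₀.val : GL (Fin 3) L) →
      𝔨.mGi.IsAdmissibleOn fun x : UnitaryGroup.arch (↥(maximalRealSubfield L)) L (IsCMField.complexConj L) 3 H =>
        Corresponds (UnitaryGroup.conjMixed (↥(maximalRealSubfield L)) L (IsCMField.complexConj L)) (UnitaryGroup.archFormOf L 3 H)
          (UnitaryGroup.archFormOf L 3 H) (cmRationalToArch L 3 H γ₀) x)
    (hpin : letI : ∀ (v : HeightOneSpectrum (𝓞 ↥(maximalRealSubfield L))) (x : (UnitaryGroup.cmDatum L 3 H).Local v),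
        MeasurableSpace ((UnitaryGroup.cmDatum L 3 H).Local v ⧸ Subgroup.centralizer ({x} : Set ((UnitaryGroup.cmDatum L 3 H).Local v))) := fun _ _ => borel _
      ∀ γ₀ : (UnitaryGroup.cmDatum L 3 H).Rational, ¬ IsRegularElt (γ₀.val : GL (Fin 3) L) →
      ∃ S₁ : Finset (HeightOneSpectrum (𝓞 ↥(maximalRealSubfield L))),
        UnitaryGroup.IsNormalisedOff L 3 H 𝔨.mG ((UnitaryGroup.cmDatum L 3 H).toAdelic γ₀) S₁)
    (hadmAG : letI : ∀ γ : GInf L, MeasurableSpace (GInf L ⧸ Subgroup.centralizer ({γ} : Set (GInf L))) := fun _ => borel _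
      ∀ γ₀ : (UnitaryGroup.cmDatum L 3 H).Rational, ¬ IsRegularElt (γ₀.val : GL (Fin 3) L) →
      𝔨.mqi.IsAdmissibleOn fun x : UnitaryGroup.arch (↥(maximalRealSubfield L)) L (IsCMField.complexConj L) 3 (splitForm L 3) =>
        Corresponds (UnitaryGroup.conjMixed (↥(maximalRealSubfield L)) L (IsCMField.complexConj L)) (UnitaryGroup.archFormOf L 3 H)
          (UnitaryGroup.archFormOf L 3 (splitForm L 3)) (cmRationalToArch L 3 H γ₀) x)
    (hEul' : SignWeightIsEuler E' wloc' warch') (hEul : SignWeightIsEulerG H E wloc warch)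
    (hone' : SignWeightLocTrivialAE wloc') (hone : SignWeightLocTrivialAEG H wloc)
    (hψe : 𝔨.PinSignTransport wloc' wloc) (harchS : 𝔨.PinSingularArchInnerTransferSigned warch' warch) :
    𝔨.SingularStableHalfSigned E' E := by
  letI : ∀ g : GpAdelic L H, MeasurableSpace (GpAdelic L H ⧸ Subgroup.centralizer ({g} : Set (GpAdelic L H))) := fun _ => borel _
  letI : ∀ γ : GpInf L H, MeasurableSpace (GpInf L H ⧸ Subgroup.centralizer ({γ} : Set (GpInf L H))) := fun _ => borel _
  letI : ∀ (v : HeightOneSpectrum (𝓞 ↥(maximalRealSubfield L))) (γ : (UnitaryGroup.cmDatum L 3 H).Local v),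
      MeasurableSpace ((UnitaryGroup.cmDatum L 3 H).Local v ⧸
        Subgroup.centralizer ({γ} : Set ((UnitaryGroup.cmDatum L 3 H).Local v))) := fun _ _ => borel _
  letI : ∀ g : GAdelic L, MeasurableSpace (GAdelic L ⧸ Subgroup.centralizer ({g} : Set (GAdelic L))) := fun _ => borel _
  letI : ∀ γ : GInf L, MeasurableSpace (GInf L ⧸ Subgroup.centralizer ({γ} : Set (GInf L))) := fun _ => borel _
  letI : ∀ (v : HeightOneSpectrum (𝓞 ↥(maximalRealSubfield L))) (γ : (UnitaryGroup.cmDatum L 3 (splitForm L 3)).Local v),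
      MeasurableSpace ((UnitaryGroup.cmDatum L 3 (splitForm L 3)).Local v ⧸
        Subgroup.centralizer ({γ} : Set ((UnitaryGroup.cmDatum L 3 (splitForm L 3)).Local v))) := fun _ _ => borel _
  haveI : ∀ g : GpAdelic L H, BorelSpace (GpAdelic L H ⧸ Subgroup.centralizer ({g} : Set (GpAdelic L H))) := fun _ => ⟨rfl⟩
  haveI : ∀ γ : GpInf L H, BorelSpace (GpInf L H ⧸ Subgroup.centralizer ({γ} : Set (GpInf L H))) := fun _ => ⟨rfl⟩
  haveI : ∀ (v : HeightOneSpectrum (𝓞 ↥(maximalRealSubfield L))) (γ : (UnitaryGroup.cmDatum L 3 H).Local v),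
      BorelSpace ((UnitaryGroup.cmDatum L 3 H).Local v ⧸
        Subgroup.centralizer ({γ} : Set ((UnitaryGroup.cmDatum L 3 H).Local v))) := fun _ _ => ⟨rfl⟩
  haveI : ∀ g : GAdelic L, BorelSpace (GAdelic L ⧸ Subgroup.centralizer ({g} : Set (GAdelic L))) := fun _ => ⟨rfl⟩
  haveI : ∀ γ : GInf L, BorelSpace (GInf L ⧸ Subgroup.centralizer ({γ} : Set (GInf L))) := fun _ => ⟨rfl⟩
  haveI : ∀ (v : HeightOneSpectrum (𝓞 ↥(maximalRealSubfield L))) (γ : (UnitaryGroup.cmDatum L 3 (splitForm L 3)).Local v),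
      BorelSpace ((UnitaryGroup.cmDatum L 3 (splitForm L 3)).Local v ⧸
        Subgroup.centralizer ({γ} : Set ((UnitaryGroup.cmDatum L 3 (splitForm L 3)).Local v))) := fun _ _ => ⟨rfl⟩
  intro f' f hTf γ₀ a b hab ha hb hγ hnc hnreg
  have hdet : H.det ≠ 0 := Literature.NumberTheory.Automorphic.Godement.det_ne_zero_of_anisotropic L H hanis
  have hss : IsSemisimpleElt (cmConjRingHom L) H γ₀ := isSemisimpleElt_of_anisotropic (cmConjRingHom L) H hanis γ₀
  obtain ⟨T, T', hT, hT', hfT, hfT', hloc, harchI⟩ := htens f' f hTf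
  obtain ⟨γ, hcorr⟩ := exists_corresponds_antidiagThree_all L H hherm hdet γ₀
  have hcorr' : ∀ (v : HeightOneSpectrum (𝓞 ↥(maximalRealSubfield L))) (x : (UnitaryGroup.cmDatum L 3 (splitForm L 3)).Local v),
      Corresponds (UnitaryGroup.conjLocal L (IsCMField.complexConj L) v)
        ((UnitaryGroup.adelicForm L 3 H).map (UnitaryGroup.adeleToLocal L v))
        ((UnitaryGroup.adelicForm L 3 (splitForm L 3)).map (UnitaryGroup.adeleToLocal L v)) ((𝔨.ψ v).symm x) x := fun v x => by
    have h := hcl v ((𝔨.ψ v).symm x)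
    rw [ContinuousMulEquiv.apply_symm_apply] at h
    exact h
  -- THINNING A ∕ B: the transported family's admissibility and the three normalisations off the base point
  have hadmG := fun v =>
    𝔨.isAdmissibleOn_mq_of_isAdmissibleOn_mG hcl v ((UnitaryGroup.cmDatum L 3 H).toLocal v ((UnitaryGroup.cmDatum L 3 H).toAdelic γ₀)) (hadmG' γ₀ hnreg v)
  have hnormG' := MatchingAdeleG₂.forall_exists_isNormalisedOff_of_mul_sub_eq_zero hherm hdet
    (corresponds_self_iff.2 (IsStablyConj.refl γ₀)) hab hγ 𝔨.mG (hadmG' γ₀ hnreg) (hpin γ₀ hnreg)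
  have hnormγG := exists_isNormalisedOff_transport_toAdelic_of_isSemisimpleElt L H 𝔨.ψ hcorr' S₀ hψK hherm hdet hss hcorr
    (hadmG' γ₀ hnreg) (hpin γ₀ hnreg)
  have hnormG := forall_exists_isNormalisedOff_transport_matchingAdeleG_of_isSemisimpleElt L H 𝔨.ψ hcorr' S₀ hψK hherm hdet hss
    (hadmG' γ₀ hnreg) (hpin γ₀ hnreg)
  -- ★-pending (SA-st-w) head at the witnesses, then back to `f′`, `f`
  have key := adelicKappaOrbitalSum_classesSelf_eq_adelicKappaOrbitalIntegralG_of_mul_sub_eq_zero hherm hdet hab hγ hcorr 𝔨.ψ hcl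
    𝔨.mG 𝔨.mGi 𝔨.mq (fun _ => rfl) 𝔨.mqi (hadmG' γ₀ hnreg) (hadmAG' γ₀ hnreg) (hpin γ₀ hnreg) hnormG' hadmG (hadmAG γ₀ hnreg) hnormγG hnormG
    T hT T' hT' hloc E' wloc' warch' (hEul' γ₀ a b hab ha hb hγ hnc) (hone' γ₀ a b hab ha hb hγ hnc) E wloc warch
    (hEul γ₀ a b hab ha hb hγ hnc) (hone γ₀ a b hab ha hb hγ hnc γ hcorr) hψe
    (harchS T T' hT.isArchTest hT'.isArchTest harchI γ₀ γ a b hcorr hab hγ)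
  rw [← hfT, ← hfT'] at key
  exact key

/-! ## §M4 THE MERGED CLOSER over the signed pins only (hSt discharged): `lawT1bNonreg_of_signed_pins` -/

/-- **T1b AT THE NON-REGULAR STABLE CLASSES from the SIGNED pins** — §M2 `lawT1bNonreg_of_pins` with `hSt := singularStableHalfSigned_of_pins …` (§M3): the
hypotheses are now MAIN pins, SPEC-O7 v2.3b texts (over the abstract weight data `E′ E wloc′ wloc warch′ warch` = A-p18 (g20)'s Kottwitz-sign letters), the
product-formula text (L2) and the four family texts of WORD #20; nothing else. [cite: Rogawski1990, §14.5 pp. 238–239; Lemma 14.5.2 p. 238; Prop. 10.1.2 p. 146;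
§3.8 Prop. 3.8.1 (a) p. 27; §4.1 (4.1.2); §14.2 (14.2.1)] [cite: Kottwitz1986, §9] [cite: Kottwitz1988, Thm. 1, Prop. 2] -/
theorem lawT1bNonreg_of_signed_pins {E' : ConjClasses (GpAdelic L H) → ℂ} {E : ConjClasses (GAdelic L) → ℂ}
    {wloc' : ∀ v : HeightOneSpectrum (𝓞 ↥(maximalRealSubfield L)), ConjClasses ((UnitaryGroup.cmDatum L 3 H).Local v) → ℂ}
    {warch' : ConjClasses (GpInf L H) → ℂ}
    {wloc : ∀ v : HeightOneSpectrum (𝓞 ↥(maximalRealSubfield L)), ConjClasses ((UnitaryGroup.cmDatum L 3 (splitForm L 3)).Local v) → ℂ}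
    {warch : ConjClasses (GInf L) → ℂ}
    (hherm : IsHermitianCM L H) (hanis : IsAnisotropic L H)
    (hJ : letI : ∀ g : GpAdelic L H, MeasurableSpace (GpAdelic L H ⧸ Subgroup.centralizer ({g} : Set (GpAdelic L H))) := fun _ => borel _
      ∀ (c : 𝔨.StClass) (f' : TestGp L H),
        𝔨.J c f' = (𝔨.eSt c).orbitalSum (UnitaryGroup.adelicClassOrbitalIntegral L 3 H 𝔨.μA f'))
    (hα : ∀ c : 𝔨.StClass, 0 < 𝔨.α c) (hTr : 𝔨.PinTransfersTo 𝔨.eStH)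
    (hC : 𝔨.PinSJGCentral) (hHi : 𝔨.PinSJHCentralImage) (hmass : 𝔨.PinMuAMassCentral) (hcc : 𝔨.PinCentralHVanish)
    (hdc : 𝔨.PinCentralValueTransfer)
    (hS : 𝔨.PinSJGSingularSigned E) (hμ : 𝔨.PinMuAShapeSingular) (hcs : 𝔨.PinSingularHRegularVanish)
    (hEM : 𝔨.PinSingularEndoscopicMass) (hRb : SignWeightReadsObs E')
    (htensH : ∀ (f' : TestGp L H) (fH : TestH L), 𝔨.TransferH f' fH →
      ∃ (T : UnitaryGroup.PureTensor L 3 H) (TH : UnitaryGroup.PureTensor₂ L (splitForm L 2) (splitForm L 1)),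
        T.IsTest ∧ ⇑f' = T.eval ∧ ⇑fH = TH.eval)
    -- pin (x): the `ψ_v` preserve classes
    (hcl : ∀ (v : HeightOneSpectrum (𝓞 ↥(maximalRealSubfield L))) (γ' : (UnitaryGroup.cmDatum L 3 H).Local v),
      Corresponds (UnitaryGroup.conjLocal L (IsCMField.complexConj L) v)
        ((UnitaryGroup.adelicForm L 3 H).map (UnitaryGroup.adeleToLocal L v))
        ((UnitaryGroup.adelicForm L 3 (splitForm L 3)).map (UnitaryGroup.adeleToLocal L v)) γ' (𝔨.ψ v γ'))
    -- pin (ix′) unpacked: tensor witnesses of `Transfer`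
    (htens : ∀ (f' : TestGp L H) (f : TestG L), 𝔨.Transfer f' f →
      letI : ∀ γ : GpInf L H, MeasurableSpace (GpInf L H ⧸ Subgroup.centralizer ({γ} : Set (GpInf L H))) := fun _ => borel _
      letI : ∀ γ : GInf L, MeasurableSpace (GInf L ⧸ Subgroup.centralizer ({γ} : Set (GInf L))) := fun _ => borel _
      ∃ (T : UnitaryGroup.PureTensor L 3 H) (T' : UnitaryGroup.PureTensor L 3 (splitForm L 3)),
        T.IsTest ∧ T'.IsTest ∧ ⇑f' = T.eval ∧ ⇑f = T'.eval ∧ (∀ v, T'.loc v = T.loc v ∘ (𝔨.ψ v).symm) ∧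
          IsArchInnerTransfer L H 𝔨.mGi 𝔨.mqi T.arch T'.arch)
    -- pin (vi): the level-matching set of the `ψ_v`
    (S₀ : Finset (HeightOneSpectrum (𝓞 ↥(maximalRealSubfield L))))
    (hψK : ∀ v, v ∉ S₀ → ∀ g, 𝔨.ψ v g ∈ UnitaryGroup.cmLocalIntegralLevel L 3 (splitForm L 3) v ↔
      g ∈ UnitaryGroup.cmLocalIntegralLevel L 3 H v)
    -- (ix-adm)∕(ix-admA)∕(ix-norm)∕(ix-admAq) at the NON-REGULAR rational classes
    (hadmG' : letI : ∀ (v : HeightOneSpectrum (𝓞 ↥(maximalRealSubfield L))) (x : (UnitaryGroup.cmDatum L 3 H).Local v),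
        MeasurableSpace ((UnitaryGroup.cmDatum L 3 H).Local v ⧸ Subgroup.centralizer ({x} : Set ((UnitaryGroup.cmDatum L 3 H).Local v))) := fun _ _ => borel _
      ∀ γ₀ : (UnitaryGroup.cmDatum L 3 H).Rational, ¬ IsRegularElt (γ₀.val : GL (Fin 3) L) →
      ∀ v, (𝔨.mG v).IsAdmissibleOn fun x : (UnitaryGroup.cmDatum L 3 H).Local v =>
        Corresponds (UnitaryGroup.conjLocal L (IsCMField.complexConj L) v)
          ((UnitaryGroup.adelicForm L 3 H).map (UnitaryGroup.adeleToLocal L v))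
          ((UnitaryGroup.adelicForm L 3 H).map (UnitaryGroup.adeleToLocal L v))
          ((UnitaryGroup.cmDatum L 3 H).toLocal v ((UnitaryGroup.cmDatum L 3 H).toAdelic γ₀)) x)
    (hadmAG' : letI : ∀ γ : GpInf L H, MeasurableSpace (GpInf L H ⧸ Subgroup.centralizer ({γ} : Set (GpInf L H))) := fun _ => borel _
      ∀ γ₀ : (UnitaryGroup.cmDatum L 3 H).Rational, ¬ IsRegularElt (γ₀.val : GL (Fin 3) L) →
      𝔨.mGi.IsAdmissibleOn fun x : UnitaryGroup.arch (↥(maximalRealSubfield L)) L (IsCMField.complexConj L) 3 H =>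
        Corresponds (UnitaryGroup.conjMixed (↥(maximalRealSubfield L)) L (IsCMField.complexConj L)) (UnitaryGroup.archFormOf L 3 H)
          (UnitaryGroup.archFormOf L 3 H) (cmRationalToArch L 3 H γ₀) x)
    (hpin : letI : ∀ (v : HeightOneSpectrum (𝓞 ↥(maximalRealSubfield L))) (x : (UnitaryGroup.cmDatum L 3 H).Local v),
        MeasurableSpace ((UnitaryGroup.cmDatum L 3 H).Local v ⧸ Subgroup.centralizer ({x} : Set ((UnitaryGroup.cmDatum L 3 H).Local v))) := fun _ _ => borel _
      ∀ γ₀ : (UnitaryGroup.cmDatum L 3 H).Rational, ¬ IsRegularElt (γ₀.val : GL (Fin 3) L) →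
      ∃ S₁ : Finset (HeightOneSpectrum (𝓞 ↥(maximalRealSubfield L))),
        UnitaryGroup.IsNormalisedOff L 3 H 𝔨.mG ((UnitaryGroup.cmDatum L 3 H).toAdelic γ₀) S₁)
    (hadmAG : letI : ∀ γ : GInf L, MeasurableSpace (GInf L ⧸ Subgroup.centralizer ({γ} : Set (GInf L))) := fun _ => borel _
      ∀ γ₀ : (UnitaryGroup.cmDatum L 3 H).Rational, ¬ IsRegularElt (γ₀.val : GL (Fin 3) L) →
      𝔨.mqi.IsAdmissibleOn fun x : UnitaryGroup.arch (↥(maximalRealSubfield L)) L (IsCMField.complexConj L) 3 (splitForm L 3) =>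
        Corresponds (UnitaryGroup.conjMixed (↥(maximalRealSubfield L)) L (IsCMField.complexConj L)) (UnitaryGroup.archFormOf L 3 H)
          (UnitaryGroup.archFormOf L 3 (splitForm L 3)) (cmRationalToArch L 3 H γ₀) x)
    (hEul' : SignWeightIsEuler E' wloc' warch') (hEul : SignWeightIsEulerG H E wloc warch)
    (hone' : SignWeightLocTrivialAE wloc') (hone : SignWeightLocTrivialAEG H wloc)
    (hψe : 𝔨.PinSignTransport wloc' wloc) (harchS : 𝔨.PinSingularArchInnerTransferSigned warch' warch) :
    𝔨.LawT1bNonreg :=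
  𝔨.lawT1bNonreg_of_pins hherm hanis hJ hα hTr hC hHi hmass hcc hdc hS hμ hcs hEM
    (𝔨.singularStableHalfSigned_of_pins hherm hanis hcl htens S₀ hψK hadmG' hadmAG' hpin hadmAG hEul' hEul hone' hone hψe harchS)
    hRb htensH hadmG' hadmAG' hpin

/-! ## §M5 INSTANTIATION AT THE KOTTWITZ SIGNS (★ `KottwitzSignCM` ∕ `KottwitzSignProductFormula` ∕ `KottwitzSignEulerFactorisation`, A-p18 (g20)):
the texts (E-fac′)(E-fac)(E-one′)(E-one)(L2) DISCHARGED; `lawT1bNonreg_of_kottwitz_pins` reads MAIN pins + SPEC-O7 v2.3b pin texts ONLY -/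

/-- **(E-one′) DISCHARGED** — ★ `eventually_kottwitzSignLocal_toAdelic_eq_one` (A-p18 (g20)) cast to `ℂ`. [cite: Rogawski1990, §4.1 (4.1.2) p. 40] -/
theorem signWeightLocTrivialAE_kottwitz (hherm : IsHermitianCM L H) (hanis : IsAnisotropic L H) :
    SignWeightLocTrivialAE (H := H) (fun v x => (((kottwitzSignLocal L 3 H v x : ℤˣ) : ℤ) : ℂ)) := by
  intro γ₀ a b hab _ha _hb hγ hnc
  have hdet : H.det ≠ 0 := Literature.NumberTheory.Automorphic.Godement.det_ne_zero_of_anisotropic L H hanis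
  filter_upwards [eventually_kottwitzSignLocal_toAdelic_eq_one hherm hdet γ₀ hab hγ (fun h => hnc ⟨a, h⟩) (fun h => hnc ⟨b, h⟩)] with v hv
  rw [hv, Units.val_one, Int.cast_one]

/-- **(E-one) DISCHARGED** — the same letter on the quasi-split form at the correspondent `γ` (split-singular and non-central with `γ₀`: ★
`mul_sub_smul_mul_sub_smul_eq_zero_of_isConj`, ★ `coe_eq_smul_one_of_isConj`; `Φ₃` hermitian non-degenerate: ★ `transpose_map_antidiagOne_three`,
★ `det_antidiagOne_three_ne_zero`). [cite: Rogawski1990, §4.1 (4.1.2) p. 40] -/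
theorem signWeightLocTrivialAEG_kottwitz :
    SignWeightLocTrivialAEG H (fun v x => (((kottwitzSignLocal L 3 (splitForm L 3) v x : ℤˣ) : ℤ) : ℂ)) := by
  intro γ₀ a b hab _ha _hb hγ hnc γ hcorr
  have hγab := mul_sub_smul_mul_sub_smul_eq_zero_of_isConj hcorr hγ
  have hγa : (((γ.val : GL (Fin 3) L)) : Matrix (Fin 3) (Fin 3) L) ≠ a • (1 : Matrix (Fin 3) (Fin 3) L) :=
    fun h => hnc ⟨a, coe_eq_smul_one_of_isConj (IsConj.symm hcorr) h⟩
  have hγb : (((γ.val : GL (Fin 3) L)) : Matrix (Fin 3) (Fin 3) L) ≠ b • (1 : Matrix (Fin 3) (Fin 3) L) :=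
    fun h => hnc ⟨b, coe_eq_smul_one_of_isConj (IsConj.symm hcorr) h⟩
  filter_upwards [eventually_kottwitzSignLocal_toAdelic_eq_one (transpose_map_antidiagOne_three L) (det_antidiagOne_three_ne_zero L) γ hab
    hγab hγa hγb] with v hv
  rw [hv, Units.val_one, Int.cast_one]

/-- **(E-fac′) DISCHARGED** — ★ `MatchingAdeleG₂.exists_finset_kottwitzSignWeight_eq_self` (A-p18 (g20)). [cite: Rogawski1990, §4.1 (4.1.2) pp. 39–40]
[cite: Kottwitz1986, Prop. 7.1] -/
theorem signWeightIsEuler_kottwitz (hherm : IsHermitianCM L H) (hanis : IsAnisotropic L H) :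
    SignWeightIsEuler (kottwitzSignWeight L 3 H) (fun v x => (((kottwitzSignLocal L 3 H v x : ℤˣ) : ℤ) : ℂ)) (kottwitzSignArchWeight L 3 H) := by
  intro γ₀ a b hab _ha _hb hγ hnc c hc
  have hdet : H.det ≠ 0 := Literature.NumberTheory.Automorphic.Godement.det_ne_zero_of_anisotropic L H hanis
  exact MatchingAdeleG₂.exists_finset_kottwitzSignWeight_eq_self hherm hdet γ₀ hab hγ (fun h => hnc ⟨a, h⟩) (fun h => hnc ⟨b, h⟩) hc

/-- **(E-fac) DISCHARGED** — ★ `MatchingAdeleG.exists_finset_kottwitzSignWeight_eq` at a rational correspondent (★ `exists_corresponds_antidiagThree_all`).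
[cite: Rogawski1990, §4.1 (4.1.2) pp. 39–40; §3.2 Thm. 3.2.1 p. 19] [cite: Kottwitz1986, Prop. 7.1] -/
theorem signWeightIsEulerG_kottwitz (hherm : IsHermitianCM L H) (hanis : IsAnisotropic L H) :
    SignWeightIsEulerG H (kottwitzSignWeight L 3 (splitForm L 3)) (fun v x => (((kottwitzSignLocal L 3 (splitForm L 3) v x : ℤˣ) : ℤ) : ℂ))
      (kottwitzSignArchWeight L 3 (splitForm L 3)) := by
  intro γ₀ a b hab _ha _hb hγ hnc c hc
  have hdet : H.det ≠ 0 := Literature.NumberTheory.Automorphic.Godement.det_ne_zero_of_anisotropic L H hanis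
  obtain ⟨γ, hcorr⟩ := exists_corresponds_antidiagThree_all L H hherm hdet γ₀
  have hγab := mul_sub_smul_mul_sub_smul_eq_zero_of_isConj hcorr hγ
  have hγa : (((γ.val : GL (Fin 3) L)) : Matrix (Fin 3) (Fin 3) L) ≠ a • (1 : Matrix (Fin 3) (Fin 3) L) :=
    fun h => hnc ⟨a, coe_eq_smul_one_of_isConj (IsConj.symm hcorr) h⟩
  have hγb : (((γ.val : GL (Fin 3) L)) : Matrix (Fin 3) (Fin 3) L) ≠ b • (1 : Matrix (Fin 3) (Fin 3) L) :=
    fun h => hnc ⟨b, coe_eq_smul_one_of_isConj (IsConj.symm hcorr) h⟩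
  exact MatchingAdeleG.exists_finset_kottwitzSignWeight_eq hcorr hab hγab hγa hγb hc

/-- **THE T1b-NONREG CLOSER AT THE KOTTWITZ SIGNS** — `lawT1bNonreg_of_signed_pins` at `E′ := kottwitzSignWeight L 3 H`, `E := kottwitzSignWeight L 3 Φ₃`,
`wloc^{(′)} := e_v`, `warch^{(′)} := kottwitzSignArchWeight`, with (E-fac′)(E-fac)(E-one′)(E-one)(L2) DISCHARGED (§M5): the hypotheses are MAIN pins (viii″)
(xiii-c) `0<α` (x) (ix′) (xi″) (vi), the SPEC-O7 texts (central (xii‴-C)(xiii‴-cc)(viii⁵-c)(c-c)(d-c); singular (xii″-s, signed) (viii‴-s) (c-s)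
(xiii″-s ⊗ κ-mass, signed) (vii-e) (b-s arch, signed)) and WORD #20's four family texts — NOTHING ELSE.
[cite: Rogawski1990, §14.5 pp. 238–239; Lemma 14.5.2 p. 238; Prop. 10.1.2 p. 146; §4.1 (4.1.2); §14.2 (14.2.1)] [cite: Kottwitz1986, §9] [cite: Kottwitz1988, Thm. 1, Prop. 2] -/
theorem lawT1bNonreg_of_kottwitz_pins (hherm : IsHermitianCM L H) (hanis : IsAnisotropic L H)
    (hJ : letI : ∀ g : GpAdelic L H, MeasurableSpace (GpAdelic L H ⧸ Subgroup.centralizer ({g} : Set (GpAdelic L H))) := fun _ => borel _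
      ∀ (c : 𝔨.StClass) (f' : TestGp L H),
        𝔨.J c f' = (𝔨.eSt c).orbitalSum (UnitaryGroup.adelicClassOrbitalIntegral L 3 H 𝔨.μA f'))
    (hα : ∀ c : 𝔨.StClass, 0 < 𝔨.α c) (hTr : 𝔨.PinTransfersTo 𝔨.eStH)
    (hC : 𝔨.PinSJGCentral) (hHi : 𝔨.PinSJHCentralImage) (hmass : 𝔨.PinMuAMassCentral) (hcc : 𝔨.PinCentralHVanish)
    (hdc : 𝔨.PinCentralValueTransfer)
    (hS : 𝔨.PinSJGSingularSigned (kottwitzSignWeight L 3 (splitForm L 3))) (hμ : 𝔨.PinMuAShapeSingular) (hcs : 𝔨.PinSingularHRegularVanish)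
    (hEM : 𝔨.PinSingularEndoscopicMass)
    (htensH : ∀ (f' : TestGp L H) (fH : TestH L), 𝔨.TransferH f' fH →
      ∃ (T : UnitaryGroup.PureTensor L 3 H) (TH : UnitaryGroup.PureTensor₂ L (splitForm L 2) (splitForm L 1)),
        T.IsTest ∧ ⇑f' = T.eval ∧ ⇑fH = TH.eval)
    -- pin (x): the `ψ_v` preserve classes
    (hcl : ∀ (v : HeightOneSpectrum (𝓞 ↥(maximalRealSubfield L))) (γ' : (UnitaryGroup.cmDatum L 3 H).Local v),
      Corresponds (UnitaryGroup.conjLocal L (IsCMField.complexConj L) v)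
        ((UnitaryGroup.adelicForm L 3 H).map (UnitaryGroup.adeleToLocal L v))
        ((UnitaryGroup.adelicForm L 3 (splitForm L 3)).map (UnitaryGroup.adeleToLocal L v)) γ' (𝔨.ψ v γ'))
    -- pin (ix′) unpacked: tensor witnesses of `Transfer`
    (htens : ∀ (f' : TestGp L H) (f : TestG L), 𝔨.Transfer f' f →
      letI : ∀ γ : GpInf L H, MeasurableSpace (GpInf L H ⧸ Subgroup.centralizer ({γ} : Set (GpInf L H))) := fun _ => borel _
      letI : ∀ γ : GInf L, MeasurableSpace (GInf L ⧸ Subgroup.centralizer ({γ} : Set (GInf L))) := fun _ => borel _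
      ∃ (T : UnitaryGroup.PureTensor L 3 H) (T' : UnitaryGroup.PureTensor L 3 (splitForm L 3)),
        T.IsTest ∧ T'.IsTest ∧ ⇑f' = T.eval ∧ ⇑f = T'.eval ∧ (∀ v, T'.loc v = T.loc v ∘ (𝔨.ψ v).symm) ∧
          IsArchInnerTransfer L H 𝔨.mGi 𝔨.mqi T.arch T'.arch)
    -- pin (vi): the level-matching set of the `ψ_v`
    (S₀ : Finset (HeightOneSpectrum (𝓞 ↥(maximalRealSubfield L))))
    (hψK : ∀ v, v ∉ S₀ → ∀ g, 𝔨.ψ v g ∈ UnitaryGroup.cmLocalIntegralLevel L 3 (splitForm L 3) v ↔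
      g ∈ UnitaryGroup.cmLocalIntegralLevel L 3 H v)
    -- (ix-adm)∕(ix-admA)∕(ix-norm)∕(ix-admAq) at the NON-REGULAR rational classes
    (hadmG' : letI : ∀ (v : HeightOneSpectrum (𝓞 ↥(maximalRealSubfield L))) (x : (UnitaryGroup.cmDatum L 3 H).Local v),
        MeasurableSpace ((UnitaryGroup.cmDatum L 3 H).Local v ⧸ Subgroup.centralizer ({x} : Set ((UnitaryGroup.cmDatum L 3 H).Local v))) := fun _ _ => borel _
      ∀ γ₀ : (UnitaryGroup.cmDatum L 3 H).Rational, ¬ IsRegularElt (γ₀.val : GL (Fin 3) L) →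
      ∀ v, (𝔨.mG v).IsAdmissibleOn fun x : (UnitaryGroup.cmDatum L 3 H).Local v =>
        Corresponds (UnitaryGroup.conjLocal L (IsCMField.complexConj L) v)
          ((UnitaryGroup.adelicForm L 3 H).map (UnitaryGroup.adeleToLocal L v))
          ((UnitaryGroup.adelicForm L 3 H).map (UnitaryGroup.adeleToLocal L v))
          ((UnitaryGroup.cmDatum L 3 H).toLocal v ((UnitaryGroup.cmDatum L 3 H).toAdelic γ₀)) x)
    (hadmAG' : letI : ∀ γ : GpInf L H, MeasurableSpace (GpInf L H ⧸ Subgroup.centralizer ({γ} : Set (GpInf L H))) := fun _ => borel _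
      ∀ γ₀ : (UnitaryGroup.cmDatum L 3 H).Rational, ¬ IsRegularElt (γ₀.val : GL (Fin 3) L) →
      𝔨.mGi.IsAdmissibleOn fun x : UnitaryGroup.arch (↥(maximalRealSubfield L)) L (IsCMField.complexConj L) 3 H =>
        Corresponds (UnitaryGroup.conjMixed (↥(maximalRealSubfield L)) L (IsCMField.complexConj L)) (UnitaryGroup.archFormOf L 3 H)
          (UnitaryGroup.archFormOf L 3 H) (cmRationalToArch L 3 H γ₀) x)
    (hpin : letI : ∀ (v : HeightOneSpectrum (𝓞 ↥(maximalRealSubfield L))) (x : (UnitaryGroup.cmDatum L 3 H).Local v),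
        MeasurableSpace ((UnitaryGroup.cmDatum L 3 H).Local v ⧸ Subgroup.centralizer ({x} : Set ((UnitaryGroup.cmDatum L 3 H).Local v))) := fun _ _ => borel _
      ∀ γ₀ : (UnitaryGroup.cmDatum L 3 H).Rational, ¬ IsRegularElt (γ₀.val : GL (Fin 3) L) →
      ∃ S₁ : Finset (HeightOneSpectrum (𝓞 ↥(maximalRealSubfield L))),
        UnitaryGroup.IsNormalisedOff L 3 H 𝔨.mG ((UnitaryGroup.cmDatum L 3 H).toAdelic γ₀) S₁)
    (hadmAG : letI : ∀ γ : GInf L, MeasurableSpace (GInf L ⧸ Subgroup.centralizer ({γ} : Set (GInf L))) := fun _ => borel _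
      ∀ γ₀ : (UnitaryGroup.cmDatum L 3 H).Rational, ¬ IsRegularElt (γ₀.val : GL (Fin 3) L) →
      𝔨.mqi.IsAdmissibleOn fun x : UnitaryGroup.arch (↥(maximalRealSubfield L)) L (IsCMField.complexConj L) 3 (splitForm L 3) =>
        Corresponds (UnitaryGroup.conjMixed (↥(maximalRealSubfield L)) L (IsCMField.complexConj L)) (UnitaryGroup.archFormOf L 3 H)
          (UnitaryGroup.archFormOf L 3 (splitForm L 3)) (cmRationalToArch L 3 H γ₀) x)
    (hconj : 𝔨.PinPsiConj)
    (harchS : 𝔨.PinSingularArchInnerTransferSigned (kottwitzSignArchWeight L 3 H) (kottwitzSignArchWeight L 3 (splitForm L 3))) :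
    𝔨.LawT1bNonreg := by
  have hdet : H.det ≠ 0 := Literature.NumberTheory.Automorphic.Godement.det_ne_zero_of_anisotropic L H hanis
  -- (d) «Kottwitz's sign IS the endoscopic character on the self-carrier»: ★ `kottwitzSignWeight_eq_of_singularObs_of_localFlip` (A-p18 (g20),
  -- `KottwitzSignReadsObs`) at the two local flips ★ `kottwitzSignLocal_toLocal_adele_eq` ∕ `kottwitzSignAt_archPart_adele_eq` (A-p17 (g16), `KottwitzSignLocalFlip`)
  have hRb : SignWeightReadsObs (kottwitzSignWeight L 3 H) :=
    kottwitzSignWeight_eq_of_singularObs_of_localFlip hherm hdet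
      (fun hab ha hb hγ₀ hα hβ q _ hg W hW v => kottwitzSignLocal_toLocal_adele_eq hherm hdet hab ha hb hγ₀ hα hβ q hg W hW v)
      (fun hab ha hb hγ₀ hα hβ q _ hg W hW w => kottwitzSignAt_archPart_adele_eq hherm hdet hab ha hb hγ₀ hα hβ q hg W hW w)
  -- (vii-e) sign transport is a THEOREM under (vii-c): ★ `kottwitzSignLocal_mk_eq_of_forall_coe_eq_conj`
  have hψe : 𝔨.PinSignTransport (fun v x => (((kottwitzSignLocal L 3 H v x : ℤˣ) : ℤ) : ℂ))
      (fun v x => (((kottwitzSignLocal L 3 (splitForm L 3) v x : ℤˣ) : ℤ) : ℂ)) := fun v x => by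
    obtain ⟨S, hS⟩ := hconj v
    have h := kottwitzSignLocal_mk_eq_of_forall_coe_eq_conj L hherm hdet (transpose_map_antidiagOne_three L) (det_antidiagOne_three_ne_zero L)
      v (𝔨.ψ v) (𝔨.ψ v).surjective S hS x
    show (((kottwitzSignLocal L 3 (splitForm L 3) v (ConjClasses.mk (𝔨.ψ v x)) : ℤˣ) : ℤ) : ℂ) =
      (((kottwitzSignLocal L 3 H v (ConjClasses.mk x) : ℤˣ) : ℤ) : ℂ)
    rw [h]
  exact 𝔨.lawT1bNonreg_of_signed_pins hherm hanis hJ hα hTr hC hHi hmass hcc hdc hS hμ hcs hEM hRb htensH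
    hcl htens S₀ hψK hadmG' hadmAG' hpin hadmAG (signWeightIsEuler_kottwitz hherm hanis) (signWeightIsEulerG_kottwitz hherm hanis)
    (signWeightLocTrivialAE_kottwitz hherm hanis) signWeightLocTrivialAEG_kottwitz hψe harchS

end Merged


/-! ## §F4 (ED 1.24b API §, RULING #119 (6)) LAW T1b AT THE NON-REGULAR CLASSES FOR EVERY PINNED KIT — `IsPinned.lawT1bNonreg` (RESIDUAL-FREE)

`lawT1bNonreg_of_kottwitz_pins` (§M5) with every hypothesis READ OFF `IsPinned` by the per-pin lemmas (WORD #120 (b) names): (viii″) `IsPinned.J_eq`, (viii′-0) `.α_pos`,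
(xiii-c) `.transfersTo_iff`, (xii‴-c) `.sjGCentral`, (xiii‴-cc) `.sjHCentralImage`, (viii⁵-c) `.muAMassCentral`, (c-c) `.centralHVanish`, (d-c) `.centralValueTransfer`,
(xii″-s) `.sjGSingular` (δ: ★ `adelicKappaOrbitalIntegralG … := adelicKappaOrbitalSum (MatchingAdeleG.classes …) …`), (viii⁵-s) `.muAShapeSingular`, (c-s) `.singularHRegularVanish`,
(xiii″-s ⊗ κ) `.singularEndoscopicMass`, (xi″) `.deltaTransfer_tensors`, (x) `.corresponds`, (ix′) `.transfer_tensors`, (vi) the level-matching set (6th conjunct),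
the four family riders (ix-adm)(ix-admA)(ix-norm)(ix-admAq), (vii-c) `.psiConj`, (b-s arch) `.singularArchInnerTransfer` (δ). -/

section F4

variable [∀ v : HeightOneSpectrum (𝓞 ↥(maximalRealSubfield L)), MeasurableSpace (HLocal L v)] [∀ v : HeightOneSpectrum (𝓞 ↥(maximalRealSubfield L)), BorelSpace (HLocal L v)]
  [∀ v : HeightOneSpectrum (𝓞 ↥(maximalRealSubfield L)), MeasurableSpace (GpLocal L H v)] [∀ v : HeightOneSpectrum (𝓞 ↥(maximalRealSubfield L)), BorelSpace (GpLocal L H v)]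
  [MeasurableSpace (GpInf L H)] [BorelSpace (GpInf L H)] [MeasurableSpace (GInf L)] [BorelSpace (GInf L)]
  [MeasurableSpace (HInf L)] [BorelSpace (HInf L)]

variable
    {νH : ∀ v : HeightOneSpectrum (𝓞 ↥(maximalRealSubfield L)), Measure (HLocal L v)} {νG : ∀ v : HeightOneSpectrum (𝓞 ↥(maximalRealSubfield L)), Measure (GpLocal L H v)}
    [∀ v, IsFiniteMeasureOnCompacts (νH v)] [∀ v, (νH v).IsMulRightInvariant]
    [∀ v, IsFiniteMeasureOnCompacts (νG v)] [∀ v, (νG v).IsMulRightInvariant]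
    {νGi : Measure (GpInf L H)} {νqi : Measure (GInf L)} {νHi : Measure (HInf L)}
    [IsFiniteMeasureOnCompacts νGi] [νGi.IsMulRightInvariant] [IsFiniteMeasureOnCompacts νqi] [νqi.IsMulRightInvariant]
    [IsFiniteMeasureOnCompacts νHi] [νHi.IsMulRightInvariant]

open Literature.NumberTheory.Rogawski1990 in
/-- **(F-4) LAW T1b AT THE NON-REGULAR STABLE CLASSES FOR EVERY PINNED KIT** (RESIDUAL-FREE): at every stable class `𝒪` of the anisotropic `G′ = U(H)` with
`¬ (eSt 𝒪).IsRegular` and every matching triple `(f′, f, f^H)`, `J(𝒪, f′) = SJ_G(𝒪, f) + ½ · Σ_{𝒪H ↦ 𝒪} SJ_H(𝒪H, f^H)` — the O7 row (central classes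
[Prop. 10.1.2 (b)(2), Lemma 14.5.2 (c), §14.5 p. 239] and split-singular classes [Prop. 10.1.2 (b)(1), Lemma 14.5.2 (a)(b), (4.1.2), Kottwitz's sign `e_𝐀`]),
`lawT1bNonreg_of_kottwitz_pins` fed by the pins of `IsPinned` BY NAME. [cite: Rogawski1990, §14.5 pp. 238–239; Lemma 14.5.2 p. 238; Prop. 10.1.2 p. 146; §4.1 (4.1.2)]
[cite: Kottwitz1986, §9] [cite: Kottwitz1988, Thm. 1, Prop. 2] -/
theorem IsPinned.lawT1bNonreg [MeasurableSpace (GpAdelic L H)] [BorelSpace (GpAdelic L H)]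
    {ν : Measure (GpAdelic L H)} [ν.IsHaarMeasure] [ν.IsInvInvariant] {Tinf : Literature.NumberTheory.Rogawski1990.ArchTransferFactor L H}
    (h : 𝔨.IsPinned ν Tinf νH νG νGi νqi νHi) (hherm : IsHermitianCM L H) (hanis : IsAnisotropic L H)
    : 𝔨.LawT1bNonreg := by
  obtain ⟨S₀, hψK, -, -⟩ := h.2.2.2.2.2.1
  exact 𝔨.lawT1bNonreg_of_kottwitz_pins hherm hanis
    (IsPinned.J_eq 𝔨 h)
    (IsPinned.α_pos 𝔨 h)
    (fun 𝒪H 𝒪 => IsPinned.transfersTo_iff 𝔨 h 𝒪H 𝒪)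
    (IsPinned.sjGCentral 𝔨 h)
    (IsPinned.sjHCentralImage 𝔨 h)
    (IsPinned.muAMassCentral 𝔨 h)
    (IsPinned.centralHVanish 𝔨 h)
    (IsPinned.centralValueTransfer 𝔨 h)
    (IsPinned.sjGSingular 𝔨 h)
    (IsPinned.muAShapeSingular 𝔨 h)
    (IsPinned.singularHRegularVanish 𝔨 h)
    (IsPinned.singularEndoscopicMass 𝔨 h)
    (fun f' fH hf => by
      obtain ⟨T, TH, hT, -, -, -, -, -, h₁, h₂, -, -⟩ := IsPinned.deltaTransfer_tensors 𝔨 h hf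
      exact ⟨T, TH, hT, h₁, h₂⟩)
    (IsPinned.corresponds 𝔨 h)
    (fun f' f hf => IsPinned.transfer_tensors 𝔨 h hf)
    S₀
    hψK
    (fun γ₀ hγ v => (IsPinned.singularFamilies 𝔨 h γ₀ hγ).1 v)
    (fun γ₀ hγ => (IsPinned.singularFamilies 𝔨 h γ₀ hγ).2.1)
    (fun γ₀ hγ => (IsPinned.singularFamilies 𝔨 h γ₀ hγ).2.2.1)
    (fun γ₀ hγ => (IsPinned.singularFamilies 𝔨 h γ₀ hγ).2.2.2)
    (IsPinned.psiConj 𝔨 h)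
    (IsPinned.singularArchInnerTransfer 𝔨 h)

open Literature.NumberTheory.Rogawski1990 in
/-- **(F-4) LAW T1b = `EllipticStabilisation` FOR EVERY PINNED KIT** (RESIDUAL-FREE): ★ API `IsPinned.ellipticStabilisation_of_lawT1bNonreg` (T1a + the regular
class clause (viii⁵) + (xiii-0)) with `LawT1bNonreg := IsPinned.lawT1bNonreg`. [cite: Rogawski1990, Thm. 14.5.1 (a) p. 238; §14.5 pp. 238–241; §5.4 Prop. 5.4.1 pp. 72–77] -/
theorem IsPinned.ellipticStabilisation [MeasurableSpace (GpAdelic L H)] [BorelSpace (GpAdelic L H)]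
    {ν : Measure (GpAdelic L H)} [ν.IsHaarMeasure] [ν.IsInvInvariant] {Tinf : Literature.NumberTheory.Rogawski1990.ArchTransferFactor L H}
    (h : 𝔨.IsPinned ν Tinf νH νG νGi νqi νHi) (hanis : IsAnisotropic L H) (hherm : IsHermitianCM L H)
    (hνG : ∀ v, (νG v).IsHaarMeasure) (hK : ∀ v : HeightOneSpectrum (𝓞 ↥(maximalRealSubfield L)), νG v (UnitaryGroup.cmLocalIntegralLevel L 3 H v : Set (GpLocal L H v)) = 1)
    (hνH : ∀ v, (νH v).IsHaarMeasure)
    (hKH : ∀ v : HeightOneSpectrum (𝓞 ↥(maximalRealSubfield L)),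
      νH v (((UnitaryGroup.cmLocalIntegralLevel L 2 (Matrix.of fun i j : Fin 2 => if i.val + j.val + 1 = 2 then (1 : L) else 0) v).prod
          (UnitaryGroup.cmLocalIntegralLevel L 1 (Matrix.of fun i j : Fin 1 => if i.val + j.val + 1 = 1 then (1 : L) else 0) v) :
            Subgroup (HLocal L v)) : Set (HLocal L v)) = 1)
    (ha : 𝔨.SimpleTraceFormula)
    : 𝔨.EllipticStabilisation :=
  IsPinned.ellipticStabilisation_of_lawT1bNonreg 𝔨 h hanis hherm hνG hK hνH hKH ha (IsPinned.lawT1bNonreg 𝔨 h hherm hanis)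

end F4

end ComparisonKit

end Summit.HodgeConjecture.HodgeConjecture.Cruxes.H413.F0T1InnerFormTraceIdentity

end
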